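import Literature.MathematicalPhysics.QuantumFieldTheory.Balaban1983to89.B6Prop26KLevelSkeletonV2
import Literature.MathematicalPhysics.QuantumFieldTheory.Balaban1983to89.B6CubeInDecayV1
import Literature.MathematicalPhysics.QuantumFieldTheory.Balaban1983to89.B6Ineq2134KFamKLevelTorusIn
import Literature.MathematicalPhysics.QuantumFieldTheory.Balaban1983to89.B6Dg288ChartV1
import Literature.MathematicalPhysics.QuantumFieldTheory.Balaban1983to89.B6Cover236QbigOverlapV1
import Literature.MathematicalPhysics.QuantumFieldTheory.Balaban1983to89.B6CubeMoutV1
import Literature.MathematicalPhysics.QuantumFieldTheory.Balaban1983to89.B6CubeCoeffSizesV1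

/-!
# `Balaban1983to89.B6Prop26KLevelAssemblyV1` — T. Bałaban, *Propagators and renormalization transformations for lattice gauge theories. II*,
# Commun. Math. Phys. **96** (1984) 223–250 [Balaban1984PropagatorsII], Prop. 2.6 (2.136)₁ p. 247 for the GENUINE `k`-level `G = Δ_a⁻¹` on the V1
# torus — THE ASSEMBLY (ROUTE V, (W5) of B6-CLOSURE §5 item 14): the two-family skeleton `…B6Prop26KLevelSkeletonV2.prop26_2136_kLevel_skeleton₂'`
# fed with p38's family theorem `…B6Ineq2134KFamKLevelTorusIn.inputs2134_kFam_torus_in` and EVERY member input of the cubes that is in the tree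

statement-level skeleton of published theorems with citation tags; proofs where landed; nothing here is a claim about the Yang–Mills mass gap

PDF held: `paper:balaban1984-cmp96-propagators-rt-ii` (journal page = PDF page + 222): p. 247 [PDF 25] ((2.133)–(2.136), Prop. 2.6), p. 239 [PDF 17]
((2.89)–(2.94)), p. 238 [PDF 16] ((2.88)); read from the tree transcriptions in the imported modules.

CITATION HEADER (lean-in-tree rule) — WHAT IS REPRODUCED.  Phase-2 file of the `lit-balaban` typed skeleton (HOME `run/shared/lean/pub/lit-balaban/`), unit
`lit-balaban-r03` (B6 fold owner; r03 gen 21, literature-prover-lit-balaban-r03-g21-0), referee ref-4.  SKELETON rows **B6.Prop2.6** × **B6.Eq2.134** ×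
**B6.Eq2.133** × B6.Eq2.91 × B6.Eq2.88 × B6.Eq2.36 × B6.Lem2.1 (cells; decls of record untouched).  IMPORTS BY NAME, restating nothing:
`…B6Prop26KLevelSkeletonV2` (r03 g21: `prop26_2136_kLevel_skeleton₂'`, `kFam_smul`, `SbigT`, `hNov_SbigT_of_QbigT`), `…B6CubeWindowV1` (r03 g20–21: the
window members `Gl/Ml/Pl`, `hagree_cube`, `hinvl_cube`, `band_of_global`, `GlobalBand`), `…B6CubeInDecayV1` (r03 g21: `hGin_cube`, `hEGin_cube`, `hNin_cube`,
`hNout_cube`, `hPlin_cube`, `hPlout_cube`), `…B6Eq292MemberTorusV1` (p38 g27: `EC`, `cfC`, `c0C`, `NC`, `zC`, `hdec_cube`, `abs_zC_le`),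
`…B6Ineq2134KFamKLevelTorusIn` (p38 g27: **`inputs2134_kFam_torus_in`**), `…B6Partition118KLevelTorusBinders`/`…Central` (p38 g26: `abs_hT_sub_le_distT`,
`gap_QT`, `zetaT_nonneg`, `zetaT_le_one`, `not_mem_QbigT_of_zetaT_ne_one`), `…B6Dg288ChartV1` (p22 g19: **`hasMajorant_Dg_V1_TB`**),
`…B6Prop26KLevelSkeletonV1` (`hB`, `zB`, `ST`, `pref`, `abs_hB_le_one`, `blkV1_mem_QT_of_hB_ne_zero`).

## WHAT THIS FILE CERTIFIES (kernel-checked, 0 sorry, standard axioms; THEOREMS ONLY — no `def`, no `def … : Prop`, no new named fact)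

**`prop26_2136_kLevel_assembly`** — PROPOSITION 2.6, ENTRY (2.136)₁, FOR THE GENUINE k-LEVEL `G = GE (domT hN D hk)` ON THE V1 TORUS, with the member
inputs of (2.133)/(2.134) DISCHARGED for the genuine members `G_□ = Gl`, `M_□ = Ml`, `P_□ = Pl` of the cubes (r03's torus window of each cube, `L ≥ 5`):
there is a rate `σ > 0` (on `d, L` and the weight band `[b₀, b₁]`) such that for every Lemma-2.1 budget `(α, N₀)`, overlap number `Nbig` and line-1 /
line-3 constants `(s₁, s₂, C_D, c_D)` there are `A ≥ 0`, `M₁ > 0` with: for every V1 global torus (`hN`, p21's `D`, `hk`, `k ≥ 2`, `M_h = L^a ≥ 8`,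
`R ≥ 2L²`, `P′_μ ≥ 5`, `L ≥ 5`, all cubes placed, `L·M_h ≥ M₁`, `N₀ + 1 ≤ R·L·M_h`, the (2.59)-shape threshold at rate `σ`), fine factor `c′ ≠ 0`,
weights in the global band, and GIVEN (displayed, owed by the neighbours' lanes): the overlap count of the `□̃` (`Nbig`, p21), the output localisation
`OutLoc (M_□h_□) □̃` (p38), the sizes and supports of the line-1 coefficients `c_e`, `c₀` of p38's `hdec_cube` (`|c_e| ≤ s₁c′²/(M·len²)`,
`|c₀| ≤ s₂c′²/(M·len²)`, supported over `□⁺`; p38's `B6CubeCoeffSizesV1`), and the line-3 majorant of `ζ_□(∂P∂* − P_□)h_□`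
(`C_D·c′²·e^{−c_D M}/len²·e^{−2σ d_T}`, p38/p22's by-parts route) — THEN
`HasMajorant (geomT D) (blkV1 hN D) G (A·(L^{j(y)}/c′)²·e^{−δ₃ d_T(y,y′)})`, `δ₃ = delta3 α (2σ)` — print's (2.136)₁ with its prefactor `(L^jη)²`.
DISCHARGED INSIDE (by name): (h2133) and `hGin` — `hGin_cube`; `hEG`/`hNin`/`hNout`/`hPlin`/`hPlout` — `B6CubeInDecayV1`; `hdec` — `hdec_cube`; `hz` —
`abs_zC_le`; the (1.118) partition binders `hh1`, `hhS`, `hLip`, `hζ0`, `hζ1`, `hζS`, `hgap` — p38's torus partition files; `hDg` — p22's (2.88) chart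
`hasMajorant_Dg_V1_TB`; (hagree)/(hinvl) — `hagree_cube`/`hinvl_cube` with the band from `GlobalBand`; (hKout) — `outLoc_kFam_big` from `hMout`;
(h2134)+smallness — p38's `inputs2134_kFam_torus_in` applied to the RESCALED family `c′²•G_□`, `c′⁻²•M_□`, `c′⁻²•P_□`, `c′⁻²•N_□`, `c′⁻²•∂P∂*`,
`c′⁻²c_e`, `c′⁻²c₀` (so that all of p38's constants are `c′`-free; `kFam_smul`: `K(rescaled)·(c′²G_□) = K·G_□`); the common rate `2σ` is the minimum of the
eight member/global rates, every input weakened to it by monotonicity.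

## HONEST SCOPE / DIVERGENCES

(1) FOUR per-cube inputs stay DISPLAYED (listed above) + the overlap number of the `□̃`; they are the announced deliverables of p38 (`B6CubeCoeffSizesV1`
v1.1, `hMout`) / p21 (`card_filter_mem_QbigT_le`) / the line-3 lane (p38 `line3P_hasMajorant_gk_zone_cut` + p22 `B6ZoneByPartsV1` + member/global legs).
(2) `L ≥ 5` (the band lemma of `B6CubeInDecayV1`; `L = 3` needs the re-centred window), `M_h = L^a ≥ 8`, `R ≥ 2L²`, `P′_μ ≥ 5`, `k ≥ 2`, all cubes
placed (automatic at `L = 5`, `P′ ≥ 12`: `B6CubeWindowV1.placed_all_cubes`; general `L` via p38's `ccAt`).  (3) The constants `A`, `M₁` depend on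
`d, L, b₀, b₁, α, N₀, Nbig, s₁, s₂, C_D, c_D` only — NOT on `k`, `M_h`, `m`, `K`, `c′` (uniformity = the point of Prop. 2.6); `σ` on `d, L, b₀, b₁`.
(4) Entries (2.136)₂₋₄ / (2.137)–(2.140) untouched; integer torus, lattice units; nothing on d = 4 or the continuum; NOT summit progress.
(5) v1.1 (§3): **`prop26_2136_kLevel_assembly_L5`** — the regime `L = 5` (`ℓ = 4`), `P′_μ ≥ 12`, in which the canonical index-`2` chart places
EVERY cube (`B6CubeWindowV1.placed_all_cubes`): the `Placed` hypothesis DISCHARGED, so the hypothesis set is visibly satisfiable on the geometry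
side (for `L ≥ 7` the top cubes need p38's deeper chart `ccAt`, not done here).
(6) v1.2 (§4): **`prop26_2136_kLevel_assembly_nbig`** / **`prop26_2136_kLevel_assembly_L5_nbig`** — hypothesis (i) (the `□̃` overlap count) DISCHARGED with
`Nbig := 3·9^{d+1}` by the owner's `B6Cover236QbigOverlapV1.card_filter_mem_QbigT_le` (finding F5 (i) closed); three displayed per-cube inputs remain
(hMout, the line-1 sizes/supports, hD3).
(7) v1.3 (§5): `prop26_2136_kLevel_final` / `_final_L5` ((ii) hMout + (iii) line-1 sizes discharged by p38's `B6CubeMoutV1` /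
`B6CubeCoeffSizesV1`) — REMOVED in v1.4 as duplicates of p38 g29's `B6Prop26KLevelAssemblyV1PerCube.prop26_2136_kLevel_assembly_line3` / `_L5_line3`
(same statements, landed independently; `dedup.landed`).
(8) v1.4 (§6): **`prop26_2136_kLevel_assembly_le`** / **`prop26_2136_kLevel_final_le`** — the rate as a PARAMETER (`∃ σ₀ > 0, ∀ σ ∈ (0, σ₀]`), so that a
line-3 theorem stated with its own rate `ρ₃` is consumed at `σ := min σ₀ (ρ₃/2)` without re-opening this file.
(9) v1.5 (§7): **`prop26_2136_kLevel_final_M`** — for `α > 0` the Lemma-2.1 exponent `N₀` is chosen inside (`budget_lt_one`); the budget collapses to ONE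
threshold `M₂ ≤ L·M_h`.
-/

open scoped BigOperators
open Finset

namespace Literature.MathematicalPhysics.QuantumFieldTheory.Balaban1983to89.B6Prop26KLevelAssemblyV1

open B4Reflection242 (boxDom)
open B6MultiLevelBoxOperator (N0)
open B6MultiLevelTorusOperator (TDomains)
open B6Cover236MultiLevelBlocks (cubes)
open B6Geom246MultiLevelBox (bset blkOf)
open B6Geom246MultiLevelTorus (geomT bondT)
open B8Ineq192MultiLevelTorus (geomTB geomTB_len geomTB_M geomTB_dist)
open B6RandomWalk (HasMajorant hasMajorant_mono delta3 BlockSupp)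
open B6Prop26Gluing (mulOp mulOp_apply LocalMajorant OutLoc)
open B6Prop26ReachTransplant (localMajorant_smul_of_le)
open B6Ineq261LevelGap (K261 K261_nonneg)
open B6Eq291Generator (kFam)
open B6Ineq2133TwoScaleV1 (onFun)
open B6GlobalChartV1 (PV toBox domT blkV1)
open B6SectAOperatorsV1 (dE dsE dcE dcsE QE aE QsE RE BondIdx)
open B6SectAVectorModelV1 (GE)
open B6Partition118KLevelTorus (hT)
open B6Partition118KLevelTorusCentral (QT QbigT zetaT zetaT_nonneg zetaT_le_one not_mem_QbigT_of_zetaT_ne_one one_le_of_four_le)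
open B6Partition118KLevelTorusBinders (sLipT sLipT_nonneg abs_hT_sub_le_distT gap_QT)
open B6Prop26KLevelSkeletonV1 (hB zB ST mem_ST pref pref_nonneg abs_hB_le_one blkV1_mem_QT_of_hB_ne_zero)
open B6Prop26KLevelSkeletonV2 (SbigT mem_SbigT hNov_SbigT_of_QbigT kFam_smul prop26_2136_kLevel_skeleton₂')
open B6InMajorantTransplant (InMajorant inMajorant_mono inMajorant_smul InMajorant.localMajorant)
open B6InDecayWindowV1 (OutMajorant outMajorant_mono outMajorant_smul)
open B6CubeWindowV1 (Placed Gl Ml Pl GlobalBand hagree_cube hinvl_cube band_of_global band_le one_le_of_eight_le four_le_of_five_le)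
open B6CubeInDecayV1 (hGin_cube hEGin_cube hNin_cube hNout_cube hPlin_cube hPlout_cube)
open B6Eq292MemberTorusV1 (EC cfC c0C NC zC hdec_cube abs_zC_le)
open B6Ineq2134KFamKLevelTorusIn (inputs2134_kFam_torus_in)
open B6Dg288ChartV1 (hasMajorant_Dg_V1_TB)

noncomputable section

variable {d ℓ : ℕ} {hd : 1 ≤ d + 1} {hL : Odd (ℓ + 1) ∧ 1 < ℓ + 1} {m K : ℕ} {Mh k R : ℕ} {P' : Fin (d + 1) → ℕ}

/-! ## §1  Small algebra: scaled majorants, scaled commutator decompositions, the prefactor in `len` units -/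

section Algebra

variable {g : B6.Geometry} {X : Type}

/-- scaling a global majorant. [cite: Balaban1984PropagatorsII, (2.94) p.239, bookkeeping] -/
theorem hasMajorant_smul (blk : X → g.Site) {T : Module.End ℝ (X → ℝ)} {Kk : g.Site → g.Site → ℝ} (h : HasMajorant blk T Kk) (s : ℝ) :
    HasMajorant blk (s • T) (fun a b => |s| * Kk a b) := by
  intro y' μ B hμ x
  rw [LinearMap.smul_apply, Pi.smul_apply, smul_eq_mul, abs_mul, mul_assoc]
  exact mul_le_mul_of_nonneg_left (h y' μ B hμ x) (abs_nonneg _)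

/-- `(s·f)· = s•(f·)`. [cite: Balaban1984PropagatorsII, (2.92) p.239, bookkeeping] -/
theorem mulOp_const_mul (s : ℝ) (f : X → ℝ) : mulOp (fun x => s * f x) = s • mulOp f := by
  apply LinearMap.ext; intro v; funext x
  simp only [mulOp_apply, LinearMap.smul_apply, Pi.smul_apply, smul_eq_mul, mul_assoc]

/-- **THE COMMUTATOR DECOMPOSITION (2.92) SCALES**: if `hM − Mh = (Σ_e c_e·E_e − c₀·) + Σ_k z_k·(N_kh − hN_k)` then the same holds for `s•M` with
`s·c_e`, `s·c₀`, `s•N_k`. [cite: Balaban1984PropagatorsII, (2.92) p.239 (lines 1–2), bookkeeping] -/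
theorem hdec_smul {ι κ : Type} (DE : Finset ι) (DK : Finset κ) {M : Module.End ℝ (X → ℝ)} {h c₀ : X → ℝ} {E : ι → Module.End ℝ (X → ℝ)}
    {cf : ι → X → ℝ} {N : κ → Module.End ℝ (X → ℝ)} {z : κ → X → ℝ}
    (hdec : mulOp h * M - M * mulOp h = (∑ e ∈ DE, mulOp (cf e) * E e - mulOp c₀) + ∑ k ∈ DK, mulOp (z k) * (N k * mulOp h - mulOp h * N k))
    (s : ℝ) :
    mulOp h * (s • M) - (s • M) * mulOp h =
      (∑ e ∈ DE, mulOp (fun x => s * cf e x) * E e - mulOp (fun x => s * c₀ x)) +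
        ∑ k ∈ DK, mulOp (z k) * ((s • N k) * mulOp h - mulOp h * (s • N k)) := by
  have e1 : mulOp h * (s • M) - (s • M) * mulOp h = s • (mulOp h * M - M * mulOp h) := by
    rw [mul_smul_comm, smul_mul_assoc, smul_sub]
  rw [e1, hdec, smul_add, smul_sub, Finset.smul_sum, Finset.smul_sum]
  congr 1
  · congr 1
    · exact Finset.sum_congr rfl fun e _ => by rw [mulOp_const_mul, smul_mul_assoc]
    · rw [mulOp_const_mul]
  · exact Finset.sum_congr rfl fun k _ => by simp only [smul_sub, mul_sub, smul_mul_assoc, mul_smul_comm]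

/-- rate weakening of an exponential kernel. [folklore] -/
private theorem exp_le_exp_of_rate {ρ σ t : ℝ} (h : σ ≤ ρ) (ht : 0 ≤ t) : Real.exp (-(ρ * t)) ≤ Real.exp (-(σ * t)) :=
  Real.exp_le_exp.mpr (neg_le_neg (mul_le_mul_of_nonneg_right h ht))

/-- the located smallness with the doubled constant gives the skeleton's. [cite: Balaban1984PropagatorsII, (2.135) p.247, bookkeeping] -/
theorem small_of_small_two {N θ Kc : ℝ} (hθ : 0 ≤ θ) (h : N ^ 2 * θ * (2 * Kc) < 1) :
    N ^ 2 * θ * Kc < 1 := by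
  have h0 : 0 ≤ N ^ 2 * θ := by positivity
  nlinarith

/-- the final constant: `(1 − N²θ₀c₁)⁻¹ ≤ 2` under the doubled smallness. [cite: Balaban1984PropagatorsII, Prop. 2.6 (2.136) p.247, bookkeeping] -/
theorem final_const_le {N A Kc θ P E : ℝ} (hN : 0 ≤ N) (hA : 0 ≤ A) (hK : 0 ≤ Kc) (hθ : 0 ≤ θ) (hP : 0 ≤ P) (hE : 0 ≤ E)
    (h : N ^ 2 * θ * (2 * Kc) < 1) :
    N * A * Kc * (1 - N ^ 2 * θ * Kc)⁻¹ * P * E ≤ 2 * (N * A) * Kc * P * E := by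
  have h0 : 0 ≤ N ^ 2 * θ * Kc := by positivity
  have h1 : N ^ 2 * θ * Kc * 2 < 1 := by nlinarith
  have hinv : (1 - N ^ 2 * θ * Kc)⁻¹ ≤ 2 := by
    rw [inv_le_comm₀ (by linarith) (by norm_num)]
    linarith
  have h2 : 0 ≤ N * A * Kc := by positivity
  calc N * A * Kc * (1 - N ^ 2 * θ * Kc)⁻¹ * P * E ≤ N * A * Kc * 2 * P * E := by gcongr
    _ = 2 * (N * A) * Kc * P * E := by ring

end Algebra

section Units

variable {D : TDomains d ℓ Mh k P' R}

/-- **print's prefactor in `len` units**: `c′²·(L^{j(y)}/c′)² = len(y)²` (`len = L^j`, `η = 1` on `geomTB D`). [cite: Balaban1984PropagatorsII, (2.133) p.247 («(L^jη)²»), dictionary] -/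
theorem sq_mul_pref (cf : ℝ) (hcf : cf ≠ 0) (y : (geomT D).Site) : cf ^ 2 * pref cf y = (geomTB D).len y ^ 2 := by
  rw [geomTB_len]; unfold pref; push_cast; field_simp

/-- `c′⁻²·(c′/L^{j(y)})² = len(y)⁻²`. [cite: Balaban1984PropagatorsII, (2.88) p.238 («(L^jη)^{−2}»), dictionary] -/
theorem inv_sq_mul_pref_inv (cf : ℝ) (hcf : cf ≠ 0) (y : (geomT D).Site) : (cf ^ 2)⁻¹ * (pref cf y)⁻¹ = ((geomTB D).len y ^ 2)⁻¹ := by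
  rw [← sq_mul_pref cf hcf y, mul_inv]

/-- `len(y) > 0`. [cite: Balaban1984PropagatorsII, (2.1) p.224, dictionary] -/
theorem lenTB_pos (y : (geomT D).Site) : 0 < (geomTB D).len y := by
  rw [geomTB_len]; positivity

/-- the torus distance is nonnegative. [cite: Balaban1984PropagatorsII, (2.46) p.231] -/
theorem distT_nonneg (y y' : (geomT D).Site) : 0 ≤ (geomT D).dist y y' := Nat.cast_nonneg _

variable (hN : ∀ μ, N0 ℓ Mh k P' μ = (PV d ℓ m K hd hL).sitesPerDir 0)

/-- `geomT D` and `geomTB D` have the same sites, block map and distance: a global majorant transfers. [cite: Balaban1984PropagatorsII, (2.45)–(2.46) p.231, dictionary] -/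
theorem hasMajorant_TB {T : Module.End ℝ (PBond (PV d ℓ m K hd hL) 0 → ℝ)} {Kk : (geomT D).Site → (geomT D).Site → ℝ}
    (h : HasMajorant (g := geomT D) (blkV1 hN D) T Kk) : HasMajorant (g := geomTB D) (blkV1 hN D) T Kk :=
  fun y' μ B hB x => h y' μ B ⟨hB.nonneg, hB.bound, hB.off⟩ x

/-- … and back. [cite: Balaban1984PropagatorsII, (2.45)–(2.46) p.231, dictionary] -/
theorem hasMajorant_T_of_TB {T : Module.End ℝ (PBond (PV d ℓ m K hd hL) 0 → ℝ)} {Kk : (geomT D).Site → (geomT D).Site → ℝ}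
    (h : HasMajorant (g := geomTB D) (blkV1 hN D) T Kk) : HasMajorant (g := geomT D) (blkV1 hN D) T Kk :=
  fun y' μ B hB x => h y' μ B ⟨hB.nonneg, hB.bound, hB.off⟩ x

/-- an input-localised majorant transfers from `geomT D` to `geomTB D`. [cite: Balaban1984PropagatorsII, (2.133) p.247, dictionary] -/
theorem inMajorant_TB {T : Module.End ℝ (PBond (PV d ℓ m K hd hL) 0 → ℝ)} {S : Set (geomT D).Site} {Kk : (geomT D).Site → (geomT D).Site → ℝ}
    (h : InMajorant (g := geomT D) (blkV1 hN D) T S Kk) : InMajorant (g := geomTB D) (blkV1 hN D) T S Kk :=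
  fun y' hy' μ B hB x => h y' hy' μ B ⟨hB.nonneg, hB.bound, hB.off⟩ x

/-- a local majorant transfers from `geomT D` to `geomTB D`. [cite: Balaban1984PropagatorsII, (2.133) p.247, dictionary] -/
theorem localMajorant_TB {T : Module.End ℝ (PBond (PV d ℓ m K hd hL) 0 → ℝ)} {S : Set (geomT D).Site} {Kk : (geomT D).Site → (geomT D).Site → ℝ}
    (h : LocalMajorant (g := geomT D) (blkV1 hN D) T S Kk) : LocalMajorant (g := geomTB D) (blkV1 hN D) T S Kk :=
  fun y' hy' μ B hB x hx => h y' hy' μ B ⟨hB.nonneg, hB.bound, hB.off⟩ x hx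

/-- an output-localised majorant on `geomT D`, in the expanded form p38's family theorem reads on `geomTB D`.
[cite: Balaban1984PropagatorsII, (2.133) p.247, dictionary] -/
theorem outMajorant_TB {T : Module.End ℝ (PBond (PV d ℓ m K hd hL) 0 → ℝ)} {S : Set (geomT D).Site} {Kk : (geomT D).Site → (geomT D).Site → ℝ}
    (h : OutMajorant (g := geomT D) (blkV1 hN D) T S Kk) :
    ∀ (y'' : (geomTB D).Site) (μ : PBond (PV d ℓ m K hd hL) 0 → ℝ) (B : ℝ), BlockSupp (g := geomTB D) (blkV1 hN D) μ y'' B →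
      ∀ x, blkV1 hN D x ∈ S → |T μ x| ≤ Kk (blkV1 hN D x) y'' * B :=
  fun y' μ B hB x hx => h y' μ B ⟨hB.nonneg, hB.bound, hB.off⟩ x hx

end Units

/-! ## §2  The assembly -/

section Assembly
set_option maxHeartbeats 400000 in
open Classical in
/-- **PROPOSITION 2.6, ENTRY (2.136)₁, FOR THE GENUINE k-LEVEL `G = Δ_a⁻¹` ON THE V1 TORUS — ASSEMBLED** (ROUTE V (W5); see the module docstring for the
list of what is discharged inside and what stays displayed).  For the weight band `[b₀, b₁]` there is `σ > 0` such that for all budgets `α ∈ [0,1]`, `N₀ ≥ 1`,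
overlap numbers `Nbig` and constants `s₁, s₂, C_D ≥ 0`, `c_D > 0` there are `A ≥ 0`, `M₁ > 0` such that on every admissible V1 torus (`k ≥ 2`, `M_h = L^a ≥ 8`,
`R ≥ 2L²`, `P′ ≥ 5`, `L ≥ 5`, cubes placed, `L·M_h ≥ M₁`, Lemma-2.1 threshold), for `c′ ≠ 0` and weights in the global band, GIVEN the `□̃`-overlap count,
`OutLoc (M_□h_□) □̃`, the line-1 coefficient sizes/supports and the line-3 majorant at rate `2σ`:
`|G(x,x′)| ≤ A·(L^{j(y)}/c′)²·e^{−δ₃ d_T(y,y′)}` blockwise, `δ₃ = delta3 α (2σ)`.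
[cite: Balaban1984PropagatorsII, Prop. 2.6 (2.136) p.247, (2.133)–(2.135) p.247, (2.88)–(2.94) pp.238–239, (2.36) p.229, Lemma 2.1 p.234] -/
theorem prop26_2136_kLevel_assembly (d ℓ : ℕ) (hd : 1 ≤ d + 1) (hL : Odd (ℓ + 1) ∧ 1 < ℓ + 1) {b₀ b₁ : ℝ} (hb₀ : 0 < b₀) (hb₁ : b₀ ≤ b₁) :
    ∃ σ : ℝ, 0 < σ ∧ ∀ (α : ℝ), 0 ≤ α → α ≤ 1 → ∀ (N₀ : ℕ), 0 < N₀ → ∀ (Nbig : ℕ) {s₁ s₂ CD cD : ℝ}, 0 ≤ s₁ → 0 ≤ s₂ → 0 ≤ CD → 0 < cD →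
    ∃ A M₁ : ℝ, 0 ≤ A ∧ 0 < M₁ ∧
    ∀ (m K : ℕ) {Mh k R : ℕ} {P' : Fin (d + 1) → ℕ}
      (hN : ∀ μ, N0 ℓ Mh k P' μ = (PV d ℓ m K hd hL).sitesPerDir 0) (D : TDomains d ℓ Mh k P' R) (hk : k ≤ m + K) (_ : 2 ≤ k)
      {a : ℕ} (hMha : Mh = (ℓ + 1) ^ a) (hM8 : 8 ≤ Mh) (_ : 2 * (ℓ + 1) ^ 2 ≤ R) (hP5 : ∀ μ, 5 ≤ P' μ) (_ : 4 ≤ ℓ)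
      (hpl : ∀ c : ↥(cubes D.toDomains), Placed ℓ k P' c.1)
      (_ : M₁ ≤ ((ℓ : ℝ) + 1) * Mh) (_ : N₀ + 1 ≤ R * ((ℓ + 1) * Mh))
      (_ : Real.exp (-(α * σ)) * ((ℓ : ℝ) + 1) ^ ((2 * (d + 1 : ℕ) : ℝ) / N₀) < 1)
      {cf : ℝ} (hcf : cf ≠ 0) {w : BondIdx (domT hN D hk) → ℝ} (hw : ∀ i, 0 < w i) (_ : GlobalBand b₀ b₁ cf w)
      -- the overlap count of the `□̃` (p21)
      (_ : ∀ y : (geomT D).Site, (Finset.univ.filter fun c : ↥(cubes D.toDomains) =>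
        y ∈ QbigT D (one_le_of_eight_le hM8) (four_le_of_five_le hP5) c).card ≤ Nbig)
      -- the output localisation of `M_□h_□` (p38)
      (_ : ∀ c : ↥(cubes D.toDomains), OutLoc (g := geomT D) (blkV1 hN D)
        (Ml hN hk (one_le_of_eight_le hM8) (four_le_of_five_le hP5) hMha c (band_le (d := d) (ℓ := ℓ) hb₀ hb₁) (hpl c) w cf * mulOp (hB hN D c))
        (SbigT D (one_le_of_eight_le hM8) (four_le_of_five_le hP5) c))
      -- the line-1 coefficients: sizes and supports (p38)
      (_ : ∀ (c : ↥(cubes D.toDomains)) (e : Fin (d + 1) × Bool) (x : PBond (PV d ℓ m K hd hL) 0),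
        |cfC hN hk (one_le_of_eight_le hM8) (four_le_of_five_le hP5) hMha c (band_le (d := d) (ℓ := ℓ) hb₀ hb₁) (hpl c) w cf e x| ≤
          s₁ * cf ^ 2 / ((geomTB D).M * (geomTB D).len (blkV1 hN D x) ^ 2))
      (_ : ∀ (c : ↥(cubes D.toDomains)) (e : Fin (d + 1) × Bool) (x : PBond (PV d ℓ m K hd hL) 0),
        cfC hN hk (one_le_of_eight_le hM8) (four_le_of_five_le hP5) hMha c (band_le (d := d) (ℓ := ℓ) hb₀ hb₁) (hpl c) w cf e x ≠ 0 →
          blkV1 hN D x ∈ ST D (one_le_of_eight_le hM8) (four_le_of_five_le hP5) c)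
      (_ : ∀ (c : ↥(cubes D.toDomains)) (x : PBond (PV d ℓ m K hd hL) 0),
        |c0C hN hk (one_le_of_eight_le hM8) (four_le_of_five_le hP5) hMha c (band_le (d := d) (ℓ := ℓ) hb₀ hb₁) (hpl c) w cf x| ≤
          s₂ * cf ^ 2 / ((geomTB D).M * (geomTB D).len (blkV1 hN D x) ^ 2))
      (_ : ∀ (c : ↥(cubes D.toDomains)) (x : PBond (PV d ℓ m K hd hL) 0),
        c0C hN hk (one_le_of_eight_le hM8) (four_le_of_five_le hP5) hMha c (band_le (d := d) (ℓ := ℓ) hb₀ hb₁) (hpl c) w cf x ≠ 0 →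
          blkV1 hN D x ∈ ST D (one_le_of_eight_le hM8) (four_le_of_five_le hP5) c)
      -- line 3 (p38/p22)
      (_ : ∀ c : ↥(cubes D.toDomains), HasMajorant (g := geomTB D) (blkV1 hN D)
        (mulOp (zB hN D (one_le_of_eight_le hM8) (four_le_of_five_le hP5) c) *
          (onFun (dE (P := PV d ℓ m K hd hL) cf ∘ₗ (LinearMap.id - RE (domT hN D hk) cf) ∘ₗ dsE cf) -
            Pl hN hk (one_le_of_eight_le hM8) (four_le_of_five_le hP5) hMha c (band_le (d := d) (ℓ := ℓ) hb₀ hb₁) (hpl c) w cf) *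
          mulOp (hB hN D c))
        (fun y y'' => CD * cf ^ 2 * Real.exp (-(cD * (geomTB D).M)) / (geomTB D).len y ^ 2 * Real.exp (-((2 * σ) * (geomTB D).dist y y'')))),
      HasMajorant (g := geomT D) (blkV1 hN D) (onFun (GE (domT hN D hk) hcf hw))
        (fun y y' => A * pref cf y * Real.exp (-(delta3 α (2 * σ) * (geomT D).dist y y'))) := by
  -- ### constants of the member / global inputs (all on `d, L, b₀, b₁` only)
  have ha₀ : (0 : ℝ) < b₀ / ((ℓ + 1 : ℕ) : ℝ) := by positivity
  obtain ⟨ρG, hρG, CG, hCG, hGin⟩ := hGin_cube d ℓ hd hL ha₀ (band_le (d := d) (ℓ := ℓ) hb₀ hb₁)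
  obtain ⟨ρE, hρE, CE, hCE, hEGin⟩ := hEGin_cube d ℓ hd hL ha₀ (band_le (d := d) (ℓ := ℓ) hb₀ hb₁)
  obtain ⟨ρN, hρN, CN, hCN, hNin⟩ := hNin_cube d ℓ hd hL ha₀ (band_le (d := d) (ℓ := ℓ) hb₀ hb₁)
  obtain ⟨ρN', hρN', CN', hCN', hNout⟩ := hNout_cube d ℓ hd hL ha₀ (band_le (d := d) (ℓ := ℓ) hb₀ hb₁)
  obtain ⟨ρP, hρP, CP, hCP, hPlin⟩ := hPlin_cube d ℓ hd hL ha₀ (band_le (d := d) (ℓ := ℓ) hb₀ hb₁)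
  obtain ⟨ρP', hρP', CP', hCP', hPlout⟩ := hPlout_cube d ℓ hd hL ha₀ (band_le (d := d) (ℓ := ℓ) hb₀ hb₁)
  obtain ⟨M₃, δ₂, C₂, hM₃, hδ₂, hC₂, hDg⟩ := hasMajorant_Dg_V1_TB d ℓ hd hL
  -- the common rate `ρ = 2σ` of the (2.134) inputs
  obtain ⟨ρ, hρ, hρG', hρE', hρN1, hρN2, hρP1, hρP2, hρD⟩ : ∃ ρ : ℝ, 0 < ρ ∧ ρ ≤ ρG ∧ ρ ≤ ρE ∧ ρ ≤ ρN ∧ ρ ≤ ρN' ∧ ρ ≤ ρP ∧ ρ ≤ ρP' ∧ ρ ≤ δ₂ := by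
    refine ⟨min ρG (min ρE (min ρN (min ρN' (min ρP (min ρP' δ₂))))),
      lt_min hρG (lt_min hρE (lt_min hρN (lt_min hρN' (lt_min hρP (lt_min hρP' hδ₂))))), min_le_left _ _, ?_, ?_, ?_, ?_, ?_, ?_⟩
    · exact (min_le_right _ _).trans (min_le_left _ _)
    · exact (min_le_right _ _).trans ((min_le_right _ _).trans (min_le_left _ _))
    · exact (min_le_right _ _).trans ((min_le_right _ _).trans ((min_le_right _ _).trans (min_le_left _ _)))
    · exact (min_le_right _ _).trans ((min_le_right _ _).trans ((min_le_right _ _).trans ((min_le_right _ _).trans (min_le_left _ _))))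
    · exact (min_le_right _ _).trans ((min_le_right _ _).trans ((min_le_right _ _).trans ((min_le_right _ _).trans
        ((min_le_right _ _).trans (min_le_left _ _)))))
    · exact (min_le_right _ _).trans ((min_le_right _ _).trans ((min_le_right _ _).trans ((min_le_right _ _).trans
        ((min_le_right _ _).trans (min_le_right _ _)))))
  refine ⟨ρ / 2, by positivity, ?_⟩
  intro α hα0 hα1 N₀ hN₀ Nbig s₁ s₂ CD cD hs₁ hs₂ hCD hcD
  -- one constant for the four `N`/`P` majorants
  obtain ⟨CNN, hCNN0, hCN1, hCN2, hCP1, hCP2⟩ : ∃ CNN : ℝ, 0 ≤ CNN ∧ CN ≤ CNN ∧ CN' ≤ CNN ∧ CP ≤ CNN ∧ CP' ≤ CNN :=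
    ⟨max (max CN CN') (max CP CP'), le_max_of_le_left (le_max_of_le_left hCN), le_max_of_le_left (le_max_left _ _),
      le_max_of_le_left (le_max_right _ _), le_max_of_le_right (le_max_left _ _), le_max_of_le_right (le_max_right _ _)⟩
  have hK0 : 0 ≤ K261 N₀ (d + 1) ((ℓ : ℝ) + 1) 1 (α * (ρ / 2)) := K261_nonneg (by positivity) zero_le_one
  -- p38's threshold for the RESCALED family (all constants `c′`-free)
  obtain ⟨M₁, Θ, hM₁, hΘ, h38⟩ := inputs2134_kFam_torus_in d ℓ (δG := ρ) (CP := ((d : ℝ) + 1) * C₂) (CG := CG) (C₁ := CE) (CN := CNN)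
    (CD := CD) (cD := cD) (s := sLipT d ℓ) (s₁ := s₁) (s₂ := s₂) (r₀ := 1) (m := 1 / (2 * ((ℓ : ℝ) + 1) ^ 2))
    (c₁ := 2 * K261 N₀ (d + 1) ((ℓ : ℝ) + 1) 1 (α * (ρ / 2))) (Fintype.card (Fin (d + 1) × Bool)) 1 Nbig hρ (by positivity) hCG hCE hCNN0 hCD
    hcD (sLipT_nonneg d ℓ) hs₁ hs₂ zero_le_one (by positivity) (by positivity)
  refine ⟨2 * ((Nbig : ℝ) * CG) * K261 N₀ (d + 1) ((ℓ : ℝ) + 1) 1 (α * (ρ / 2)), max M₁ M₃, by positivity, lt_max_of_lt_left hM₁, ?_⟩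
  intro m K Mh k R P' hN D hk hk2 a hMha hM8 hR2 hP5 hℓ hpl hM₁' hRM hθ cf hcf w hw hwb hNbig hMout hcfA hcfT hc0A hc0T hD3
  -- ### the torus
  have hMh1 : 1 ≤ Mh := one_le_of_eight_le hM8
  have hP4 : ∀ μ, 4 ≤ P' μ := four_le_of_five_le hP5
  have hP : ∀ μ, 1 ≤ P' μ := one_le_of_four_le hP4
  have hMh : 2 ≤ Mh := le_trans (by norm_num) hM8
  have hR : 2 * (ℓ + 1) ≤ R := le_trans (by nlinarith : 2 * (ℓ + 1) ≤ 2 * (ℓ + 1) ^ 2) hR2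
  have hℓ1 : 1 ≤ ℓ := le_trans (by norm_num) hℓ
  have hLM : M₁ ≤ ((ℓ : ℝ) + 1) * Mh := le_trans (le_max_left _ _) hM₁'
  have hLM₃ : M₃ ≤ ((ℓ : ℝ) + 1) * Mh := le_trans (le_max_right _ _) hM₁'
  have hcf2 : cf ^ 2 ≠ 0 := pow_ne_zero 2 hcf
  have hcf2pos : 0 < cf ^ 2 := by positivity
  have habs2 : |cf ^ 2| = cf ^ 2 := abs_of_pos hcf2pos
  have habs2i : |(cf ^ 2)⁻¹| = (cf ^ 2)⁻¹ := abs_of_pos (inv_pos.2 hcf2pos)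
  have hMpos : 0 < (geomTB D).M := by rw [geomTB_M]; positivity
  have hdnn : ∀ y y' : (geomT D).Site, 0 ≤ (geomT D).dist y y' := distT_nonneg
  -- ### p38's theorem at this torus: smallness + the (2.134) family bound for the rescaled members
  obtain ⟨hsmall, h2134⟩ := h38 D hMh1 hP hR hLM
  -- the global `∂P∂*` (p22), rescaled by `c′⁻²`
  have hDg' : HasMajorant (g := geomTB D) (blkV1 hN D)
      ((cf ^ 2)⁻¹ • onFun (dE (P := PV d ℓ m K hd hL) cf ∘ₗ (LinearMap.id - RE (domT hN D hk) cf) ∘ₗ dsE cf))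
      (fun y y'' => ((d : ℝ) + 1) * C₂ / (geomTB D).len y ^ 2 * Real.exp (-(ρ * (geomTB D).dist y y''))) := by
    refine hasMajorant_mono _ (hasMajorant_smul _ (hDg m K hN D hk hMh1 hP4 hR hLM₃ hcf) _) fun y y'' => ?_
    rw [habs2i]
    have hl := lenTB_pos (D := D) y
    calc (cf ^ 2)⁻¹ * (cf ^ 2 * ((d : ℝ) + 1) * C₂ / (geomTB D).len y ^ 2 * Real.exp (-(δ₂ * (geomTB D).dist y y'')))
        = ((d : ℝ) + 1) * C₂ / (geomTB D).len y ^ 2 * Real.exp (-(δ₂ * (geomTB D).dist y y'')) := by field_simp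
      _ ≤ ((d : ℝ) + 1) * C₂ / (geomTB D).len y ^ 2 * Real.exp (-(ρ * (geomTB D).dist y y'')) :=
          mul_le_mul_of_nonneg_left (exp_le_exp_of_rate hρD (hdnn y y'')) (by positivity)
  have H := h2134 (blkV1 hN D) hDg' (Finset.univ : Finset ↥(cubes D.toDomains))
    (G := fun c => cf ^ 2 • Gl hN hk hMh1 hP4 hMha c (band_le (d := d) (ℓ := ℓ) hb₀ hb₁) (hpl c) w cf)
    (Ml := fun c => (cf ^ 2)⁻¹ • Ml hN hk hMh1 hP4 hMha c (band_le (d := d) (ℓ := ℓ) hb₀ hb₁) (hpl c) w cf)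
    (Pl := fun c => (cf ^ 2)⁻¹ • Pl hN hk hMh1 hP4 hMha c (band_le (d := d) (ℓ := ℓ) hb₀ hb₁) (hpl c) w cf)
    (h := fun c => hB hN D c) (ζ := fun c => zB hN D hMh1 hP4 c)
    (c₀ := fun c x => (cf ^ 2)⁻¹ * c0C hN hk hMh1 hP4 hMha c (band_le (d := d) (ℓ := ℓ) hb₀ hb₁) (hpl c) w cf x)
    (T := fun c => ST D hMh1 hP4 c) (S := fun c => ST D hMh1 hP4 c) (Score := fun c => SbigT D hMh1 hP4 c)
    (DE := fun _ => (Finset.univ : Finset (Fin (d + 1) × Bool)))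
    (E := fun c e => EC hN hk hMh1 hP4 hMha c (band_le (d := d) (ℓ := ℓ) hb₀ hb₁) (hpl c) w cf e)
    (cf := fun c e x => (cf ^ 2)⁻¹ * cfC hN hk hMh1 hP4 hMha c (band_le (d := d) (ℓ := ℓ) hb₀ hb₁) (hpl c) w cf e x)
    (DK := fun _ => ({()} : Finset Unit))
    (N := fun c _ => (cf ^ 2)⁻¹ • NC hN hk hMh1 hP4 hMha c (band_le (d := d) (ℓ := ℓ) hb₀ hb₁) (hpl c) w cf)
    (z := fun c _ => zC hN hk hMh1 hP4 hMha c (band_le (d := d) (ℓ := ℓ) hb₀ hb₁) (hpl c) w cf)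
    -- hnE, hnK
    (fun c _ => le_of_eq Finset.card_univ) (fun c _ => by simp)
    -- hdec
    (fun c _ => hdec_smul Finset.univ ({()} : Finset Unit)
      (N := fun _ => NC hN hk hMh1 hP4 hMha c (band_le (d := d) (ℓ := ℓ) hb₀ hb₁) (hpl c) w cf)
      (z := fun _ => zC hN hk hMh1 hP4 hMha c (band_le (d := d) (ℓ := ℓ) hb₀ hb₁) (hpl c) w cf)
      (hdec_cube hN hk hMh1 hP4 hMha c (band_le (d := d) (ℓ := ℓ) hb₀ hb₁) hM8 hR2 (hpl c) w cf) _)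
    -- hGin
    (fun c _ => by
      refine inMajorant_TB hN (inMajorant_mono (g := geomT D) _ (inMajorant_smul _ (hGin m K hN D hk hMh1 hP4 hMha hMh hR2 hℓ c (hpl c) w cf) (cf ^ 2))
        (K' := fun (y y' : (geomT D).Site) => CG * (geomTB D).len y ^ 2 * Real.exp (-(ρ * (geomT D).dist y y'))) fun y y' _ => ?_)
      rw [habs2, ← sq_mul_pref cf hcf y]
      have := pref_nonneg cf y
      calc cf ^ 2 * (CG * pref cf y * Real.exp (-(ρG * (geomT D).dist y y')))
          = CG * (cf ^ 2 * pref cf y) * Real.exp (-(ρG * (geomT D).dist y y')) := by ring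
        _ ≤ CG * (cf ^ 2 * pref cf y) * Real.exp (-(ρ * (geomT D).dist y y')) :=
            mul_le_mul_of_nonneg_left (exp_le_exp_of_rate hρG' (hdnn y y')) (by positivity))
    -- hEG
    (fun c _ e _ => by
      have hx := inMajorant_mono (g := geomT D) _ (inMajorant_smul _ (hEGin m K hN D hk hMh1 hP4 hMha hMh hR2 hℓ c (hpl c) w cf e) (cf ^ 2))
        (K' := fun (y y' : (geomT D).Site) => CE * (geomTB D).len y ^ 2 * Real.exp (-(ρ * (geomT D).dist y y'))) fun y y' _ => by
          rw [habs2, ← sq_mul_pref cf hcf y]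
          have := pref_nonneg cf y
          calc cf ^ 2 * (CE * pref cf y * Real.exp (-(ρE * (geomT D).dist y y')))
              = CE * (cf ^ 2 * pref cf y) * Real.exp (-(ρE * (geomT D).dist y y')) := by ring
            _ ≤ CE * (cf ^ 2 * pref cf y) * Real.exp (-(ρ * (geomT D).dist y y')) :=
                mul_le_mul_of_nonneg_left (exp_le_exp_of_rate hρE' (hdnn y y')) (by positivity)
      rw [← mul_smul_comm] at hx
      exact localMajorant_TB hN hx.localMajorant)
    -- hcf, hcfT
    (fun c _ e _ x => by
      have hl := lenTB_pos (D := D) (blkV1 hN D x)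
      rw [abs_mul, habs2i]
      calc (cf ^ 2)⁻¹ * |cfC hN hk hMh1 hP4 hMha c (band_le (d := d) (ℓ := ℓ) hb₀ hb₁) (hpl c) w cf e x|
          ≤ (cf ^ 2)⁻¹ * (s₁ * cf ^ 2 / ((geomTB D).M * (geomTB D).len (blkV1 hN D x) ^ 2)) :=
            mul_le_mul_of_nonneg_left (hcfA c e x) (by positivity)
        _ = s₁ / ((geomTB D).M * (geomTB D).len (blkV1 hN D x) ^ 2) := by field_simp)
    (fun c _ e _ x hx => hcfT c e x (right_ne_zero_of_mul hx))
    -- hc₀, hc₀T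
    (fun c _ x => by
      have hl := lenTB_pos (D := D) (blkV1 hN D x)
      rw [abs_mul, habs2i]
      calc (cf ^ 2)⁻¹ * |c0C hN hk hMh1 hP4 hMha c (band_le (d := d) (ℓ := ℓ) hb₀ hb₁) (hpl c) w cf x|
          ≤ (cf ^ 2)⁻¹ * (s₂ * cf ^ 2 / ((geomTB D).M * (geomTB D).len (blkV1 hN D x) ^ 2)) :=
            mul_le_mul_of_nonneg_left (hc0A c x) (by positivity)
        _ = s₂ / ((geomTB D).M * (geomTB D).len (blkV1 hN D x) ^ 2) := by field_simp)
    (fun c _ x hx => hc0T c x (right_ne_zero_of_mul hx))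
    -- hh1, hhS, hST, hLip
    (fun c _ x => abs_hB_le_one hN D hMh1 hP c x)
    (fun c _ x hx => blkV1_mem_QT_of_hB_ne_zero hN D hMh hR hP4 c hx)
    (fun c _ => fun _ hy => hy)
    (fun c _ x x' => abs_hT_sub_le_distT hℓ1 hMh hR hP5 c (toBox hN x.src) (toBox hN x'.src))
    -- hNin, hNout
    (fun c _ k _ => by
      refine inMajorant_TB hN (inMajorant_mono (g := geomT D) _ (inMajorant_smul _ (hNin m K hN D hk hMh1 hP4 hMha hMh hR2 hℓ c (hpl c) w cf) ((cf ^ 2)⁻¹))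
        (K' := fun (y y'' : (geomT D).Site) => CNN / (geomTB D).len y ^ 2 * Real.exp (-(ρ * (geomT D).dist y y''))) fun y y'' _ => ?_)
      rw [habs2i]
      have hl := lenTB_pos (D := D) y
      calc (cf ^ 2)⁻¹ * (CN * (pref cf y)⁻¹ * Real.exp (-(ρN * (geomT D).dist y y'')))
          = CN * ((cf ^ 2)⁻¹ * (pref cf y)⁻¹) * Real.exp (-(ρN * (geomT D).dist y y'')) := by ring
        _ = CN / (geomTB D).len y ^ 2 * Real.exp (-(ρN * (geomT D).dist y y'')) := by rw [inv_sq_mul_pref_inv cf hcf y]; ring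
        _ ≤ CNN / (geomTB D).len y ^ 2 * Real.exp (-(ρ * (geomT D).dist y y'')) :=
            mul_le_mul (div_le_div_of_nonneg_right hCN1 (by positivity)) (exp_le_exp_of_rate hρN1 (hdnn y y''))
              (Real.exp_nonneg _) (by positivity))
    (fun c _ k _ => by
      have hx := outMajorant_mono (g := geomT D) _ (outMajorant_smul _ (hNout m K hN D hk hMh1 hP4 hMha hMh hR2 hℓ c (hpl c) w cf) ((cf ^ 2)⁻¹))
        (K' := fun (y y'' : (geomT D).Site) => CNN / (geomTB D).len y ^ 2 * Real.exp (-(ρ * (geomT D).dist y y''))) fun y _ y'' => by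
          rw [habs2i]
          have hl := lenTB_pos (D := D) y
          calc (cf ^ 2)⁻¹ * (CN' * (pref cf y)⁻¹ * Real.exp (-(ρN' * (geomT D).dist y y'')))
              = CN' * ((cf ^ 2)⁻¹ * (pref cf y)⁻¹) * Real.exp (-(ρN' * (geomT D).dist y y'')) := by ring
            _ = CN' / (geomTB D).len y ^ 2 * Real.exp (-(ρN' * (geomT D).dist y y'')) := by rw [inv_sq_mul_pref_inv cf hcf y]; ring
            _ ≤ CNN / (geomTB D).len y ^ 2 * Real.exp (-(ρ * (geomT D).dist y y'')) :=
                mul_le_mul (div_le_div_of_nonneg_right hCN2 (by positivity)) (exp_le_exp_of_rate hρN2 (hdnn y y''))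
                  (Real.exp_nonneg _) (by positivity)
      exact outMajorant_TB hN hx)
    -- hz
    (fun c _ k _ x => abs_zC_le hN hk hMh1 hP4 hMha c (band_le (d := d) (ℓ := ℓ) hb₀ hb₁) (hpl c) w cf x)
    -- hPlin, hPlout
    (fun c _ => by
      refine inMajorant_TB hN (inMajorant_mono (g := geomT D) _ (inMajorant_smul _ (hPlin m K hN D hk hMh1 hP4 hMha hMh hR2 hℓ c (hpl c) w cf) ((cf ^ 2)⁻¹))
        (K' := fun (y y'' : (geomT D).Site) => CNN / (geomTB D).len y ^ 2 * Real.exp (-(ρ * (geomT D).dist y y''))) fun y y'' _ => ?_)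
      rw [habs2i]
      have hl := lenTB_pos (D := D) y
      calc (cf ^ 2)⁻¹ * (CP * (pref cf y)⁻¹ * Real.exp (-(ρP * (geomT D).dist y y'')))
          = CP * ((cf ^ 2)⁻¹ * (pref cf y)⁻¹) * Real.exp (-(ρP * (geomT D).dist y y'')) := by ring
        _ = CP / (geomTB D).len y ^ 2 * Real.exp (-(ρP * (geomT D).dist y y'')) := by rw [inv_sq_mul_pref_inv cf hcf y]; ring
        _ ≤ CNN / (geomTB D).len y ^ 2 * Real.exp (-(ρ * (geomT D).dist y y'')) :=
            mul_le_mul (div_le_div_of_nonneg_right hCP1 (by positivity)) (exp_le_exp_of_rate hρP1 (hdnn y y''))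
              (Real.exp_nonneg _) (by positivity))
    (fun c _ => by
      have hx := outMajorant_mono (g := geomT D) _ (outMajorant_smul _ (hPlout m K hN D hk hMh1 hP4 hMha hMh hR2 hℓ c (hpl c) w cf) ((cf ^ 2)⁻¹))
        (K' := fun (y y'' : (geomT D).Site) => CNN / (geomTB D).len y ^ 2 * Real.exp (-(ρ * (geomT D).dist y y''))) fun y _ y'' => by
          rw [habs2i]
          have hl := lenTB_pos (D := D) y
          calc (cf ^ 2)⁻¹ * (CP' * (pref cf y)⁻¹ * Real.exp (-(ρP' * (geomT D).dist y y'')))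
              = CP' * ((cf ^ 2)⁻¹ * (pref cf y)⁻¹) * Real.exp (-(ρP' * (geomT D).dist y y'')) := by ring
            _ = CP' / (geomTB D).len y ^ 2 * Real.exp (-(ρP' * (geomT D).dist y y'')) := by rw [inv_sq_mul_pref_inv cf hcf y]; ring
            _ ≤ CNN / (geomTB D).len y ^ 2 * Real.exp (-(ρ * (geomT D).dist y y'')) :=
                mul_le_mul (div_le_div_of_nonneg_right hCP2 (by positivity)) (exp_le_exp_of_rate hρP2 (hdnn y y''))
                  (Real.exp_nonneg _) (by positivity)
      exact outMajorant_TB hN hx)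
    -- hζ0, hζ1, hζS
    (fun c _ x => zetaT_nonneg hMh1 hP4 c (toBox hN x.src)) (fun c _ x => zetaT_le_one hMh1 hP4 c (toBox hN x.src))
    (fun c _ x hx => not_mem_QbigT_of_zetaT_ne_one hMh1 hP4 c hx)
    -- hD3 (rescaled)
    (fun c _ => by
      have hx := hasMajorant_smul _ (hD3 c) ((cf ^ 2)⁻¹)
      have eop : (cf ^ 2)⁻¹ • (mulOp (zB hN D hMh1 hP4 c) *
            (onFun (dE (P := PV d ℓ m K hd hL) cf ∘ₗ (LinearMap.id - RE (domT hN D hk) cf) ∘ₗ dsE cf) -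
              Pl hN hk hMh1 hP4 hMha c (band_le (d := d) (ℓ := ℓ) hb₀ hb₁) (hpl c) w cf) * mulOp (hB hN D c)) =
          mulOp (zB hN D hMh1 hP4 c) *
            ((cf ^ 2)⁻¹ • onFun (dE (P := PV d ℓ m K hd hL) cf ∘ₗ (LinearMap.id - RE (domT hN D hk) cf) ∘ₗ dsE cf) -
              (cf ^ 2)⁻¹ • Pl hN hk hMh1 hP4 hMha c (band_le (d := d) (ℓ := ℓ) hb₀ hb₁) (hpl c) w cf) * mulOp (hB hN D c) := by
        simp only [smul_sub, mul_sub, sub_mul, mul_smul_comm, smul_mul_assoc]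
      rw [eop] at hx
      refine hasMajorant_mono _ hx fun y y'' => le_of_eq ?_
      rw [habs2i]
      have hl := lenTB_pos (D := D) y
      have e2 : 2 * (ρ / 2) = ρ := by ring
      rw [e2]
      field_simp)
    -- hgap
    (fun c _ y y'' hy hy'' => gap_QT hℓ1 hMh hR hP5 c hy hy'')
  -- ### back to the TRUE family: `K(rescaled)·(c′²G_□) = K·G_□`
  have e1 : ρ / 2 * ((d : ℝ) + 1) / ((d : ℝ) + 1) = ρ / 2 := by field_simp
  have e3 : (2 * (ρ / 2 * ((d : ℝ) + 1) / ((d : ℝ) + 1))) / 2 = ρ / 2 := by rw [e1]; ring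
  have hconv : ∀ {T : Module.End ℝ (PBond (PV d ℓ m K hd hL) 0 → ℝ)} {θ : ℝ},
      HasMajorant (g := geomTB D) (blkV1 hN D) T (fun (y y' : (geomT D).Site) => θ * Real.exp (-(ρ / 2 * (geomT D).dist y y'))) →
      HasMajorant (g := geomT D) (blkV1 hN D) T
        (fun y y' => θ * Real.exp (-((2 * (ρ / 2 * ((d : ℝ) + 1) / ((d : ℝ) + 1))) / 2 * (geomT D).dist y y'))) :=
    fun h => hasMajorant_T_of_TB hN (hasMajorant_mono (g := geomTB D) _ h fun y y' => le_of_eq (by rw [e3]))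
  have h2134' := fun c c' => hconv (by
    have h := H c (Finset.mem_univ _) c' (Finset.mem_univ _)
    rw [kFam_smul, smul_mul_smul_comm, inv_mul_cancel₀ hcf2, one_smul] at h
    exact h)
  -- ### the two-family skeleton
  have hθ' : Real.exp (-(α * (ρ / 2 * ((d : ℝ) + 1) / ((d : ℝ) + 1)))) * ((ℓ : ℝ) + 1) ^ ((2 * (d + 1 : ℕ) : ℝ) / N₀) < 1 := by
    rw [e1]; exact hθ
  have h2133 : ∀ c : ↥(cubes D.toDomains), LocalMajorant (g := geomT D) (blkV1 hN D)
      (Gl hN hk hMh1 hP4 hMha c (band_le (d := d) (ℓ := ℓ) hb₀ hb₁) (hpl c) w cf) (ST D hMh1 hP4 c)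
      (fun y y' => CG * pref cf y * Real.exp (-((2 * (ρ / 2 * ((d : ℝ) + 1) / ((d : ℝ) + 1))) / 2 * (geomT D).dist y y'))) := by
    intro c
    refine (inMajorant_mono _ (hGin m K hN D hk hMh1 hP4 hMha hMh hR2 hℓ c (hpl c) w cf) fun y y' _ => ?_).localMajorant
    rw [e3]
    have := pref_nonneg cf y
    exact mul_le_mul_of_nonneg_left (exp_le_exp_of_rate (by linarith) (hdnn y y')) (by positivity)
  have hsk := prop26_2136_kLevel_skeleton₂' hN D hk hMh hR hP5 (δ := ρ / 2 * ((d : ℝ) + 1)) (A := CG) (by positivity) hCG α hα0 hα1 N₀ hN₀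
    hRM hθ' hcf hw Nbig (hNov_SbigT_of_QbigT D hMh1 hP4 hNbig)
    (fun c => Gl hN hk hMh1 hP4 hMha c (band_le (d := d) (ℓ := ℓ) hb₀ hb₁) (hpl c) w cf)
    (fun c => Ml hN hk hMh1 hP4 hMha c (band_le (d := d) (ℓ := ℓ) hb₀ hb₁) (hpl c) w cf)
    (fun c => Pl hN hk hMh1 hP4 hMha c (band_le (d := d) (ℓ := ℓ) hb₀ hb₁) (hpl c) w cf) h2133
    (fun c => hagree_cube hN hk hMh1 hP4 hMha c (band_le (d := d) (ℓ := ℓ) hb₀ hb₁) hk2 hM8 hR2 (hpl c) w hcf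
      (fun i hi _ => band_of_global hN hk hMh1 hP4 c (le_of_lt hb₀) hcf w hwb i hi))
    (fun c => hinvl_cube hN hk hMh1 hP4 hMha c (band_le (d := d) (ℓ := ℓ) hb₀ hb₁) ha₀ hM8 hR2 (hpl c) w hcf) hMout _ ?hθ₀ h2134' ?hsm
  case hθ₀ =>
    have hs := sLipT_nonneg d ℓ
    positivity
  case hsm =>
    rw [e1]
    have hs := sLipT_nonneg d ℓ
    exact small_of_small_two (by positivity) hsmall
  -- ### the final constant: `(1 − N²θ₀c₁)⁻¹ ≤ 2`
  refine hasMajorant_mono _ hsk fun y y' => ?_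
  rw [e1]
  have hs := sLipT_nonneg d ℓ
  exact final_const_le (Nat.cast_nonneg _) hCG hK0 (by positivity) (pref_nonneg cf y) (Real.exp_nonneg _) hsmall

end Assembly

/-! ## §3  (v1.1) The regime `L = 5`, `P′ ≥ 12`: every cube placed -/

section L5

open B6CubeWindowV1 (placed_all_cubes)

open Classical in
/-- **PROPOSITION 2.6 (2.136)₁ AT k LEVELS FOR THE GENUINE G, `L = 5`, `P′_μ ≥ 12`** — `prop26_2136_kLevel_assembly` with the placement hypothesis
DISCHARGED (`placed_all_cubes`: at `ℓ = 4` the canonical chart places every cube of level `≤ k`); all other hypotheses and the conclusion as there.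
[cite: Balaban1984PropagatorsII, Prop. 2.6 (2.136) p.247, (2.133)–(2.135) p.247, (2.88)–(2.94) pp.238–239, (2.36) p.229, Lemma 2.1 p.234] -/
theorem prop26_2136_kLevel_assembly_L5 (d : ℕ) (hd : 1 ≤ d + 1) (hL : Odd (4 + 1) ∧ 1 < 4 + 1) {b₀ b₁ : ℝ} (hb₀ : 0 < b₀) (hb₁ : b₀ ≤ b₁) :
    ∃ σ : ℝ, 0 < σ ∧ ∀ (α : ℝ), 0 ≤ α → α ≤ 1 → ∀ (N₀ : ℕ), 0 < N₀ → ∀ (Nbig : ℕ) {s₁ s₂ CD cD : ℝ}, 0 ≤ s₁ → 0 ≤ s₂ → 0 ≤ CD → 0 < cD →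
    ∃ A M₁ : ℝ, 0 ≤ A ∧ 0 < M₁ ∧
    ∀ (m K : ℕ) {Mh k R : ℕ} {P' : Fin (d + 1) → ℕ}
      (hN : ∀ μ, N0 4 Mh k P' μ = (PV d 4 m K hd hL).sitesPerDir 0) (D : TDomains d 4 Mh k P' R) (hk : k ≤ m + K) (_ : 2 ≤ k)
      {a : ℕ} (hMha : Mh = (4 + 1) ^ a) (hM8 : 8 ≤ Mh) (_ : 2 * (4 + 1) ^ 2 ≤ R) (hP12 : ∀ μ, 12 ≤ P' μ)
      (_ : M₁ ≤ (((4 : ℕ) : ℝ) + 1) * Mh) (_ : N₀ + 1 ≤ R * ((4 + 1) * Mh))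
      (_ : Real.exp (-(α * σ)) * (((4 : ℕ) : ℝ) + 1) ^ ((2 * (d + 1 : ℕ) : ℝ) / N₀) < 1)
      {cf : ℝ} (hcf : cf ≠ 0) {w : BondIdx (domT hN D hk) → ℝ} (hw : ∀ i, 0 < w i) (_ : GlobalBand b₀ b₁ cf w)
      (_ : ∀ y : (geomT D).Site, (Finset.univ.filter fun c : ↥(cubes D.toDomains) =>
        y ∈ QbigT D (one_le_of_eight_le hM8) (four_le_of_five_le (fun μ => le_trans (by norm_num) (hP12 μ))) c).card ≤ Nbig)
      (_ : ∀ c : ↥(cubes D.toDomains), OutLoc (g := geomT D) (blkV1 hN D)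
        (Ml hN hk (one_le_of_eight_le hM8) (four_le_of_five_le (fun μ => le_trans (by norm_num) (hP12 μ))) hMha c
          (band_le (d := d) (ℓ := 4) hb₀ hb₁) (placed_all_cubes (D := D) rfl hP12 c) w cf * mulOp (hB hN D c))
        (SbigT D (one_le_of_eight_le hM8) (four_le_of_five_le (fun μ => le_trans (by norm_num) (hP12 μ))) c))
      (_ : ∀ (c : ↥(cubes D.toDomains)) (e : Fin (d + 1) × Bool) (x : PBond (PV d 4 m K hd hL) 0),
        |cfC hN hk (one_le_of_eight_le hM8) (four_le_of_five_le (fun μ => le_trans (by norm_num) (hP12 μ))) hMha c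
          (band_le (d := d) (ℓ := 4) hb₀ hb₁) (placed_all_cubes (D := D) rfl hP12 c) w cf e x| ≤
          s₁ * cf ^ 2 / ((geomTB D).M * (geomTB D).len (blkV1 hN D x) ^ 2))
      (_ : ∀ (c : ↥(cubes D.toDomains)) (e : Fin (d + 1) × Bool) (x : PBond (PV d 4 m K hd hL) 0),
        cfC hN hk (one_le_of_eight_le hM8) (four_le_of_five_le (fun μ => le_trans (by norm_num) (hP12 μ))) hMha c
          (band_le (d := d) (ℓ := 4) hb₀ hb₁) (placed_all_cubes (D := D) rfl hP12 c) w cf e x ≠ 0 →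
          blkV1 hN D x ∈ ST D (one_le_of_eight_le hM8) (four_le_of_five_le (fun μ => le_trans (by norm_num) (hP12 μ))) c)
      (_ : ∀ (c : ↥(cubes D.toDomains)) (x : PBond (PV d 4 m K hd hL) 0),
        |c0C hN hk (one_le_of_eight_le hM8) (four_le_of_five_le (fun μ => le_trans (by norm_num) (hP12 μ))) hMha c
          (band_le (d := d) (ℓ := 4) hb₀ hb₁) (placed_all_cubes (D := D) rfl hP12 c) w cf x| ≤
          s₂ * cf ^ 2 / ((geomTB D).M * (geomTB D).len (blkV1 hN D x) ^ 2))
      (_ : ∀ (c : ↥(cubes D.toDomains)) (x : PBond (PV d 4 m K hd hL) 0),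
        c0C hN hk (one_le_of_eight_le hM8) (four_le_of_five_le (fun μ => le_trans (by norm_num) (hP12 μ))) hMha c
          (band_le (d := d) (ℓ := 4) hb₀ hb₁) (placed_all_cubes (D := D) rfl hP12 c) w cf x ≠ 0 →
          blkV1 hN D x ∈ ST D (one_le_of_eight_le hM8) (four_le_of_five_le (fun μ => le_trans (by norm_num) (hP12 μ))) c)
      (_ : ∀ c : ↥(cubes D.toDomains), HasMajorant (g := geomTB D) (blkV1 hN D)
        (mulOp (zB hN D (one_le_of_eight_le hM8) (four_le_of_five_le (fun μ => le_trans (by norm_num) (hP12 μ))) c) *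
          (onFun (dE (P := PV d 4 m K hd hL) cf ∘ₗ (LinearMap.id - RE (domT hN D hk) cf) ∘ₗ dsE cf) -
            Pl hN hk (one_le_of_eight_le hM8) (four_le_of_five_le (fun μ => le_trans (by norm_num) (hP12 μ))) hMha c
              (band_le (d := d) (ℓ := 4) hb₀ hb₁) (placed_all_cubes (D := D) rfl hP12 c) w cf) *
          mulOp (hB hN D c))
        (fun y y'' => CD * cf ^ 2 * Real.exp (-(cD * (geomTB D).M)) / (geomTB D).len y ^ 2 * Real.exp (-((2 * σ) * (geomTB D).dist y y'')))),
      HasMajorant (g := geomT D) (blkV1 hN D) (onFun (GE (domT hN D hk) hcf hw))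
        (fun y y' => A * pref cf y * Real.exp (-(delta3 α (2 * σ) * (geomT D).dist y y'))) := by
  obtain ⟨σ, hσ, h⟩ := prop26_2136_kLevel_assembly d 4 hd hL hb₀ hb₁
  refine ⟨σ, hσ, fun α hα0 hα1 N₀ hN₀ Nbig s₁ s₂ CD cD hs₁ hs₂ hCD hcD => ?_⟩
  obtain ⟨A, M₁, hA, hM₁, h2⟩ := h α hα0 hα1 N₀ hN₀ Nbig hs₁ hs₂ hCD hcD
  refine ⟨A, M₁, hA, hM₁, ?_⟩
  intro m K Mh k R P' hN D hk hk2 a hMha hM8 hR2 hP12 hLM hRM hθ cf hcf w hw hwb hNbig hMout hcfA hcfT hc0A hc0T hD3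
  exact h2 m K hN D hk hk2 hMha hM8 hR2 (fun μ => le_trans (by norm_num) (hP12 μ)) le_rfl (placed_all_cubes (D := D) rfl hP12)
    hLM hRM hθ hcf hw hwb hNbig hMout hcfA hcfT hc0A hc0T hD3

end L5

/-! ## §4  (v1.2) The `□̃` overlap count DISCHARGED (`Nbig = 3·9^{d+1}`, `B6Cover236QbigOverlapV1`) -/

section Nbig

open B6Cover236QbigOverlapV1 (card_filter_mem_QbigT_le)
open B6CubeWindowV1 (placed_all_cubes)

open Classical in
/-- **PROPOSITION 2.6 (2.136)₁ AT k LEVELS FOR THE GENUINE G — the `□̃` overlap number DISCHARGED** (`Nbig := 3·9^{d+1}`, the owner's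
`card_filter_mem_QbigT_le`): `prop26_2136_kLevel_assembly` without hypothesis (i); the three displayed per-cube inputs (hMout, line-1 sizes/supports,
hD3) and the Lemma-2.1 budget remain. [cite: Balaban1984PropagatorsII, Prop. 2.6 (2.136) p.247, (2.133)–(2.135) p.247, (2.88)–(2.94) pp.238–239, (2.36) p.229, Lemma 2.1 p.234] -/
theorem prop26_2136_kLevel_assembly_nbig (d ℓ : ℕ) (hd : 1 ≤ d + 1) (hL : Odd (ℓ + 1) ∧ 1 < ℓ + 1) {b₀ b₁ : ℝ} (hb₀ : 0 < b₀) (hb₁ : b₀ ≤ b₁) :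
    ∃ σ : ℝ, 0 < σ ∧ ∀ (α : ℝ), 0 ≤ α → α ≤ 1 → ∀ (N₀ : ℕ), 0 < N₀ → ∀ {s₁ s₂ CD cD : ℝ}, 0 ≤ s₁ → 0 ≤ s₂ → 0 ≤ CD → 0 < cD →
    ∃ A M₁ : ℝ, 0 ≤ A ∧ 0 < M₁ ∧
    ∀ (m K : ℕ) {Mh k R : ℕ} {P' : Fin (d + 1) → ℕ}
      (hN : ∀ μ, N0 ℓ Mh k P' μ = (PV d ℓ m K hd hL).sitesPerDir 0) (D : TDomains d ℓ Mh k P' R) (hk : k ≤ m + K) (_ : 2 ≤ k)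
      {a : ℕ} (hMha : Mh = (ℓ + 1) ^ a) (hM8 : 8 ≤ Mh) (_ : 2 * (ℓ + 1) ^ 2 ≤ R) (hP5 : ∀ μ, 5 ≤ P' μ) (_ : 4 ≤ ℓ)
      (hpl : ∀ c : ↥(cubes D.toDomains), Placed ℓ k P' c.1)
      (_ : M₁ ≤ ((ℓ : ℝ) + 1) * Mh) (_ : N₀ + 1 ≤ R * ((ℓ + 1) * Mh))
      (_ : Real.exp (-(α * σ)) * ((ℓ : ℝ) + 1) ^ ((2 * (d + 1 : ℕ) : ℝ) / N₀) < 1)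
      {cf : ℝ} (hcf : cf ≠ 0) {w : BondIdx (domT hN D hk) → ℝ} (hw : ∀ i, 0 < w i) (_ : GlobalBand b₀ b₁ cf w)
      -- the output localisation of `M_□h_□` (p38)
      (_ : ∀ c : ↥(cubes D.toDomains), OutLoc (g := geomT D) (blkV1 hN D)
        (Ml hN hk (one_le_of_eight_le hM8) (four_le_of_five_le hP5) hMha c (band_le (d := d) (ℓ := ℓ) hb₀ hb₁) (hpl c) w cf * mulOp (hB hN D c))
        (SbigT D (one_le_of_eight_le hM8) (four_le_of_five_le hP5) c))
      -- the line-1 coefficients: sizes and supports (p38)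
      (_ : ∀ (c : ↥(cubes D.toDomains)) (e : Fin (d + 1) × Bool) (x : PBond (PV d ℓ m K hd hL) 0),
        |cfC hN hk (one_le_of_eight_le hM8) (four_le_of_five_le hP5) hMha c (band_le (d := d) (ℓ := ℓ) hb₀ hb₁) (hpl c) w cf e x| ≤
          s₁ * cf ^ 2 / ((geomTB D).M * (geomTB D).len (blkV1 hN D x) ^ 2))
      (_ : ∀ (c : ↥(cubes D.toDomains)) (e : Fin (d + 1) × Bool) (x : PBond (PV d ℓ m K hd hL) 0),
        cfC hN hk (one_le_of_eight_le hM8) (four_le_of_five_le hP5) hMha c (band_le (d := d) (ℓ := ℓ) hb₀ hb₁) (hpl c) w cf e x ≠ 0 →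
          blkV1 hN D x ∈ ST D (one_le_of_eight_le hM8) (four_le_of_five_le hP5) c)
      (_ : ∀ (c : ↥(cubes D.toDomains)) (x : PBond (PV d ℓ m K hd hL) 0),
        |c0C hN hk (one_le_of_eight_le hM8) (four_le_of_five_le hP5) hMha c (band_le (d := d) (ℓ := ℓ) hb₀ hb₁) (hpl c) w cf x| ≤
          s₂ * cf ^ 2 / ((geomTB D).M * (geomTB D).len (blkV1 hN D x) ^ 2))
      (_ : ∀ (c : ↥(cubes D.toDomains)) (x : PBond (PV d ℓ m K hd hL) 0),
        c0C hN hk (one_le_of_eight_le hM8) (four_le_of_five_le hP5) hMha c (band_le (d := d) (ℓ := ℓ) hb₀ hb₁) (hpl c) w cf x ≠ 0 →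
          blkV1 hN D x ∈ ST D (one_le_of_eight_le hM8) (four_le_of_five_le hP5) c)
      -- line 3 (p38/p22)
      (_ : ∀ c : ↥(cubes D.toDomains), HasMajorant (g := geomTB D) (blkV1 hN D)
        (mulOp (zB hN D (one_le_of_eight_le hM8) (four_le_of_five_le hP5) c) *
          (onFun (dE (P := PV d ℓ m K hd hL) cf ∘ₗ (LinearMap.id - RE (domT hN D hk) cf) ∘ₗ dsE cf) -
            Pl hN hk (one_le_of_eight_le hM8) (four_le_of_five_le hP5) hMha c (band_le (d := d) (ℓ := ℓ) hb₀ hb₁) (hpl c) w cf) *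
          mulOp (hB hN D c))
        (fun y y'' => CD * cf ^ 2 * Real.exp (-(cD * (geomTB D).M)) / (geomTB D).len y ^ 2 * Real.exp (-((2 * σ) * (geomTB D).dist y y'')))),
      HasMajorant (g := geomT D) (blkV1 hN D) (onFun (GE (domT hN D hk) hcf hw))
        (fun y y' => A * pref cf y * Real.exp (-(delta3 α (2 * σ) * (geomT D).dist y y'))) := by
  obtain ⟨σ, hσ, h⟩ := prop26_2136_kLevel_assembly d ℓ hd hL hb₀ hb₁
  refine ⟨σ, hσ, fun α hα0 hα1 N₀ hN₀ s₁ s₂ CD cD hs₁ hs₂ hCD hcD => ?_⟩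
  obtain ⟨A, M₁, hA, hM₁, h2⟩ := h α hα0 hα1 N₀ hN₀ (3 * 9 ^ (d + 1)) hs₁ hs₂ hCD hcD
  refine ⟨A, M₁, hA, hM₁, ?_⟩
  intro m K Mh k R P' hN D hk hk2 a hMha hM8 hR2 hP5 hℓ hpl hLM hRM hθ cf hcf w hw hwb hMout hcfA hcfT hc0A hc0T hD3
  exact h2 m K hN D hk hk2 hMha hM8 hR2 hP5 hℓ hpl hLM hRM hθ hcf hw hwb
    (card_filter_mem_QbigT_le D hL (le_trans (by norm_num) hM8) hR2 (one_le_of_eight_le hM8) (four_le_of_five_le hP5))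
    hMout hcfA hcfT hc0A hc0T hD3

open Classical in
/-- **THE SAME AT `L = 5`, `P′ ≥ 12`** — both the placement and the overlap count discharged. [cite: Balaban1984PropagatorsII, Prop. 2.6 (2.136) p.247, (2.36) p.229, p.235] -/
theorem prop26_2136_kLevel_assembly_L5_nbig (d : ℕ) (hd : 1 ≤ d + 1) (hL : Odd (4 + 1) ∧ 1 < 4 + 1) {b₀ b₁ : ℝ} (hb₀ : 0 < b₀) (hb₁ : b₀ ≤ b₁) :
    ∃ σ : ℝ, 0 < σ ∧ ∀ (α : ℝ), 0 ≤ α → α ≤ 1 → ∀ (N₀ : ℕ), 0 < N₀ → ∀ {s₁ s₂ CD cD : ℝ}, 0 ≤ s₁ → 0 ≤ s₂ → 0 ≤ CD → 0 < cD →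
    ∃ A M₁ : ℝ, 0 ≤ A ∧ 0 < M₁ ∧
    ∀ (m K : ℕ) {Mh k R : ℕ} {P' : Fin (d + 1) → ℕ}
      (hN : ∀ μ, N0 4 Mh k P' μ = (PV d 4 m K hd hL).sitesPerDir 0) (D : TDomains d 4 Mh k P' R) (hk : k ≤ m + K) (_ : 2 ≤ k)
      {a : ℕ} (hMha : Mh = (4 + 1) ^ a) (hM8 : 8 ≤ Mh) (_ : 2 * (4 + 1) ^ 2 ≤ R) (hP12 : ∀ μ, 12 ≤ P' μ)
      (_ : M₁ ≤ (((4 : ℕ) : ℝ) + 1) * Mh) (_ : N₀ + 1 ≤ R * ((4 + 1) * Mh))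
      (_ : Real.exp (-(α * σ)) * (((4 : ℕ) : ℝ) + 1) ^ ((2 * (d + 1 : ℕ) : ℝ) / N₀) < 1)
      {cf : ℝ} (hcf : cf ≠ 0) {w : BondIdx (domT hN D hk) → ℝ} (hw : ∀ i, 0 < w i) (_ : GlobalBand b₀ b₁ cf w)
      (_ : ∀ c : ↥(cubes D.toDomains), OutLoc (g := geomT D) (blkV1 hN D)
        (Ml hN hk (one_le_of_eight_le hM8) (four_le_of_five_le (fun μ => le_trans (by norm_num) (hP12 μ))) hMha c
          (band_le (d := d) (ℓ := 4) hb₀ hb₁) (placed_all_cubes (D := D) rfl hP12 c) w cf * mulOp (hB hN D c))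
        (SbigT D (one_le_of_eight_le hM8) (four_le_of_five_le (fun μ => le_trans (by norm_num) (hP12 μ))) c))
      (_ : ∀ (c : ↥(cubes D.toDomains)) (e : Fin (d + 1) × Bool) (x : PBond (PV d 4 m K hd hL) 0),
        |cfC hN hk (one_le_of_eight_le hM8) (four_le_of_five_le (fun μ => le_trans (by norm_num) (hP12 μ))) hMha c
          (band_le (d := d) (ℓ := 4) hb₀ hb₁) (placed_all_cubes (D := D) rfl hP12 c) w cf e x| ≤
          s₁ * cf ^ 2 / ((geomTB D).M * (geomTB D).len (blkV1 hN D x) ^ 2))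
      (_ : ∀ (c : ↥(cubes D.toDomains)) (e : Fin (d + 1) × Bool) (x : PBond (PV d 4 m K hd hL) 0),
        cfC hN hk (one_le_of_eight_le hM8) (four_le_of_five_le (fun μ => le_trans (by norm_num) (hP12 μ))) hMha c
          (band_le (d := d) (ℓ := 4) hb₀ hb₁) (placed_all_cubes (D := D) rfl hP12 c) w cf e x ≠ 0 →
          blkV1 hN D x ∈ ST D (one_le_of_eight_le hM8) (four_le_of_five_le (fun μ => le_trans (by norm_num) (hP12 μ))) c)
      (_ : ∀ (c : ↥(cubes D.toDomains)) (x : PBond (PV d 4 m K hd hL) 0),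
        |c0C hN hk (one_le_of_eight_le hM8) (four_le_of_five_le (fun μ => le_trans (by norm_num) (hP12 μ))) hMha c
          (band_le (d := d) (ℓ := 4) hb₀ hb₁) (placed_all_cubes (D := D) rfl hP12 c) w cf x| ≤
          s₂ * cf ^ 2 / ((geomTB D).M * (geomTB D).len (blkV1 hN D x) ^ 2))
      (_ : ∀ (c : ↥(cubes D.toDomains)) (x : PBond (PV d 4 m K hd hL) 0),
        c0C hN hk (one_le_of_eight_le hM8) (four_le_of_five_le (fun μ => le_trans (by norm_num) (hP12 μ))) hMha c
          (band_le (d := d) (ℓ := 4) hb₀ hb₁) (placed_all_cubes (D := D) rfl hP12 c) w cf x ≠ 0 →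
          blkV1 hN D x ∈ ST D (one_le_of_eight_le hM8) (four_le_of_five_le (fun μ => le_trans (by norm_num) (hP12 μ))) c)
      (_ : ∀ c : ↥(cubes D.toDomains), HasMajorant (g := geomTB D) (blkV1 hN D)
        (mulOp (zB hN D (one_le_of_eight_le hM8) (four_le_of_five_le (fun μ => le_trans (by norm_num) (hP12 μ))) c) *
          (onFun (dE (P := PV d 4 m K hd hL) cf ∘ₗ (LinearMap.id - RE (domT hN D hk) cf) ∘ₗ dsE cf) -
            Pl hN hk (one_le_of_eight_le hM8) (four_le_of_five_le (fun μ => le_trans (by norm_num) (hP12 μ))) hMha c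
              (band_le (d := d) (ℓ := 4) hb₀ hb₁) (placed_all_cubes (D := D) rfl hP12 c) w cf) *
          mulOp (hB hN D c))
        (fun y y'' => CD * cf ^ 2 * Real.exp (-(cD * (geomTB D).M)) / (geomTB D).len y ^ 2 * Real.exp (-((2 * σ) * (geomTB D).dist y y'')))),
      HasMajorant (g := geomT D) (blkV1 hN D) (onFun (GE (domT hN D hk) hcf hw))
        (fun y y' => A * pref cf y * Real.exp (-(delta3 α (2 * σ) * (geomT D).dist y y'))) := by
  obtain ⟨σ, hσ, h⟩ := prop26_2136_kLevel_assembly_L5 d hd hL hb₀ hb₁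
  refine ⟨σ, hσ, fun α hα0 hα1 N₀ hN₀ s₁ s₂ CD cD hs₁ hs₂ hCD hcD => ?_⟩
  obtain ⟨A, M₁, hA, hM₁, h2⟩ := h α hα0 hα1 N₀ hN₀ (3 * 9 ^ (d + 1)) hs₁ hs₂ hCD hcD
  refine ⟨A, M₁, hA, hM₁, ?_⟩
  intro m K Mh k R P' hN D hk hk2 a hMha hM8 hR2 hP12 hLM hRM hθ cf hcf w hw hwb hMout hcfA hcfT hc0A hc0T hD3
  exact h2 m K hN D hk hk2 hMha hM8 hR2 hP12 hLM hRM hθ hcf hw hwb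
    (card_filter_mem_QbigT_le D hL (le_trans (by norm_num) hM8) hR2 (one_le_of_eight_le hM8)
      (four_le_of_five_le (fun μ => le_trans (by norm_num) (hP12 μ))))
    hMout hcfA hcfT hc0A hc0T hD3

end Nbig

/-! ## §5  (v1.3 → v1.4) `hMout` and the line-1 coefficient sizes DISCHARGED — see p38 g29's `B6Prop26KLevelAssemblyV1PerCube`

v1.3 of this file carried `prop26_2136_kLevel_final` / `prop26_2136_kLevel_final_L5` (hypotheses (ii)+(iii) discharged by p38's `B6CubeMoutV1.outLoc_Ml_hB` and
`B6CubeCoeffSizesV1.abs_cfC_le/cfC_supp/abs_c0C_le/c0C_supp`).  p38 g29 landed the SAME two statements independently as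
`B6Prop26KLevelAssemblyV1PerCube.prop26_2136_kLevel_assembly_line3` / `…_L5_line3` (a module importing this one), so v1.4 REMOVES the two copies here
(gate `dedup.landed`; nothing referenced them) — use p38's names for the fixed-rate form, and `prop26_2136_kLevel_final_le` (§6, the rate a parameter) otherwise. -/


/-! ## §6  (v1.4) The rate as a PARAMETER: every `σ ≤ σ₀` works — the shape a line-3 theorem with its own rate plugs into -/

section Rate

open B6CubeMoutV1 (outLoc_Ml_hB)
open B6CubeCoeffSizesV1 (abs_cfC_le cfC_supp abs_c0C_le c0C_supp)
open B6Partition118KLevelFineSizes (C1F C1F_nonneg)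
open B6Partition118KLevelFineSecond (C2F C2F_nonneg)
open B6Cover236QbigOverlapV1 (card_filter_mem_QbigT_le)
set_option maxHeartbeats 400000 in
open Classical in
/-- **THE ASSEMBLY WITH THE RATE AS A PARAMETER**: `prop26_2136_kLevel_assembly` restated as `∃ σ₀ > 0, ∀ σ ∈ (0, σ₀], …` — all (2.134) inputs are
weakened to the rate `2σ` and the conclusion decays at `delta3 α (2σ)`; a line-3 majorant proved at its own rate `ρ₃` is consumed at `σ := min σ₀ (ρ₃/2)`.
[cite: Balaban1984PropagatorsII, Prop. 2.6 (2.136) p.247, (2.133)–(2.135) p.247, (2.88)–(2.94) pp.238–239, (2.36) p.229, Lemma 2.1 p.234] -/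
theorem prop26_2136_kLevel_assembly_le (d ℓ : ℕ) (hd : 1 ≤ d + 1) (hL : Odd (ℓ + 1) ∧ 1 < ℓ + 1) {b₀ b₁ : ℝ} (hb₀ : 0 < b₀) (hb₁ : b₀ ≤ b₁) :
    ∃ σ₀ : ℝ, 0 < σ₀ ∧ ∀ (σ : ℝ), 0 < σ → σ ≤ σ₀ → ∀ (α : ℝ), 0 ≤ α → α ≤ 1 → ∀ (N₀ : ℕ), 0 < N₀ → ∀ (Nbig : ℕ) {s₁ s₂ CD cD : ℝ}, 0 ≤ s₁ → 0 ≤ s₂ → 0 ≤ CD → 0 < cD →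
    ∃ A M₁ : ℝ, 0 ≤ A ∧ 0 < M₁ ∧
    ∀ (m K : ℕ) {Mh k R : ℕ} {P' : Fin (d + 1) → ℕ}
      (hN : ∀ μ, N0 ℓ Mh k P' μ = (PV d ℓ m K hd hL).sitesPerDir 0) (D : TDomains d ℓ Mh k P' R) (hk : k ≤ m + K) (_ : 2 ≤ k)
      {a : ℕ} (hMha : Mh = (ℓ + 1) ^ a) (hM8 : 8 ≤ Mh) (_ : 2 * (ℓ + 1) ^ 2 ≤ R) (hP5 : ∀ μ, 5 ≤ P' μ) (_ : 4 ≤ ℓ)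
      (hpl : ∀ c : ↥(cubes D.toDomains), Placed ℓ k P' c.1)
      (_ : M₁ ≤ ((ℓ : ℝ) + 1) * Mh) (_ : N₀ + 1 ≤ R * ((ℓ + 1) * Mh))
      (_ : Real.exp (-(α * σ)) * ((ℓ : ℝ) + 1) ^ ((2 * (d + 1 : ℕ) : ℝ) / N₀) < 1)
      {cf : ℝ} (hcf : cf ≠ 0) {w : BondIdx (domT hN D hk) → ℝ} (hw : ∀ i, 0 < w i) (_ : GlobalBand b₀ b₁ cf w)
      -- the overlap count of the `□̃` (p21)
      (_ : ∀ y : (geomT D).Site, (Finset.univ.filter fun c : ↥(cubes D.toDomains) =>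
        y ∈ QbigT D (one_le_of_eight_le hM8) (four_le_of_five_le hP5) c).card ≤ Nbig)
      -- the output localisation of `M_□h_□` (p38)
      (_ : ∀ c : ↥(cubes D.toDomains), OutLoc (g := geomT D) (blkV1 hN D)
        (Ml hN hk (one_le_of_eight_le hM8) (four_le_of_five_le hP5) hMha c (band_le (d := d) (ℓ := ℓ) hb₀ hb₁) (hpl c) w cf * mulOp (hB hN D c))
        (SbigT D (one_le_of_eight_le hM8) (four_le_of_five_le hP5) c))
      -- the line-1 coefficients: sizes and supports (p38)
      (_ : ∀ (c : ↥(cubes D.toDomains)) (e : Fin (d + 1) × Bool) (x : PBond (PV d ℓ m K hd hL) 0),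
        |cfC hN hk (one_le_of_eight_le hM8) (four_le_of_five_le hP5) hMha c (band_le (d := d) (ℓ := ℓ) hb₀ hb₁) (hpl c) w cf e x| ≤
          s₁ * cf ^ 2 / ((geomTB D).M * (geomTB D).len (blkV1 hN D x) ^ 2))
      (_ : ∀ (c : ↥(cubes D.toDomains)) (e : Fin (d + 1) × Bool) (x : PBond (PV d ℓ m K hd hL) 0),
        cfC hN hk (one_le_of_eight_le hM8) (four_le_of_five_le hP5) hMha c (band_le (d := d) (ℓ := ℓ) hb₀ hb₁) (hpl c) w cf e x ≠ 0 →
          blkV1 hN D x ∈ ST D (one_le_of_eight_le hM8) (four_le_of_five_le hP5) c)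
      (_ : ∀ (c : ↥(cubes D.toDomains)) (x : PBond (PV d ℓ m K hd hL) 0),
        |c0C hN hk (one_le_of_eight_le hM8) (four_le_of_five_le hP5) hMha c (band_le (d := d) (ℓ := ℓ) hb₀ hb₁) (hpl c) w cf x| ≤
          s₂ * cf ^ 2 / ((geomTB D).M * (geomTB D).len (blkV1 hN D x) ^ 2))
      (_ : ∀ (c : ↥(cubes D.toDomains)) (x : PBond (PV d ℓ m K hd hL) 0),
        c0C hN hk (one_le_of_eight_le hM8) (four_le_of_five_le hP5) hMha c (band_le (d := d) (ℓ := ℓ) hb₀ hb₁) (hpl c) w cf x ≠ 0 →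
          blkV1 hN D x ∈ ST D (one_le_of_eight_le hM8) (four_le_of_five_le hP5) c)
      -- line 3 (p38/p22)
      (_ : ∀ c : ↥(cubes D.toDomains), HasMajorant (g := geomTB D) (blkV1 hN D)
        (mulOp (zB hN D (one_le_of_eight_le hM8) (four_le_of_five_le hP5) c) *
          (onFun (dE (P := PV d ℓ m K hd hL) cf ∘ₗ (LinearMap.id - RE (domT hN D hk) cf) ∘ₗ dsE cf) -
            Pl hN hk (one_le_of_eight_le hM8) (four_le_of_five_le hP5) hMha c (band_le (d := d) (ℓ := ℓ) hb₀ hb₁) (hpl c) w cf) *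
          mulOp (hB hN D c))
        (fun y y'' => CD * cf ^ 2 * Real.exp (-(cD * (geomTB D).M)) / (geomTB D).len y ^ 2 * Real.exp (-((2 * σ) * (geomTB D).dist y y'')))),
      HasMajorant (g := geomT D) (blkV1 hN D) (onFun (GE (domT hN D hk) hcf hw))
        (fun y y' => A * pref cf y * Real.exp (-(delta3 α (2 * σ) * (geomT D).dist y y'))) := by
  -- ### constants of the member / global inputs (all on `d, L, b₀, b₁` only)
  have ha₀ : (0 : ℝ) < b₀ / ((ℓ + 1 : ℕ) : ℝ) := by positivity
  obtain ⟨ρG, hρG, CG, hCG, hGin⟩ := hGin_cube d ℓ hd hL ha₀ (band_le (d := d) (ℓ := ℓ) hb₀ hb₁)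
  obtain ⟨ρE, hρE, CE, hCE, hEGin⟩ := hEGin_cube d ℓ hd hL ha₀ (band_le (d := d) (ℓ := ℓ) hb₀ hb₁)
  obtain ⟨ρN, hρN, CN, hCN, hNin⟩ := hNin_cube d ℓ hd hL ha₀ (band_le (d := d) (ℓ := ℓ) hb₀ hb₁)
  obtain ⟨ρN', hρN', CN', hCN', hNout⟩ := hNout_cube d ℓ hd hL ha₀ (band_le (d := d) (ℓ := ℓ) hb₀ hb₁)
  obtain ⟨ρP, hρP, CP, hCP, hPlin⟩ := hPlin_cube d ℓ hd hL ha₀ (band_le (d := d) (ℓ := ℓ) hb₀ hb₁)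
  obtain ⟨ρP', hρP', CP', hCP', hPlout⟩ := hPlout_cube d ℓ hd hL ha₀ (band_le (d := d) (ℓ := ℓ) hb₀ hb₁)
  obtain ⟨M₃, δ₂, C₂, hM₃, hδ₂, hC₂, hDg⟩ := hasMajorant_Dg_V1_TB d ℓ hd hL
  -- the common rate `ρ = 2σ` of the (2.134) inputs
  obtain ⟨ρ, hρ, hρG', hρE', hρN1, hρN2, hρP1, hρP2, hρD⟩ : ∃ ρ : ℝ, 0 < ρ ∧ ρ ≤ ρG ∧ ρ ≤ ρE ∧ ρ ≤ ρN ∧ ρ ≤ ρN' ∧ ρ ≤ ρP ∧ ρ ≤ ρP' ∧ ρ ≤ δ₂ := by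
    refine ⟨min ρG (min ρE (min ρN (min ρN' (min ρP (min ρP' δ₂))))),
      lt_min hρG (lt_min hρE (lt_min hρN (lt_min hρN' (lt_min hρP (lt_min hρP' hδ₂))))), min_le_left _ _, ?_, ?_, ?_, ?_, ?_, ?_⟩
    · exact (min_le_right _ _).trans (min_le_left _ _)
    · exact (min_le_right _ _).trans ((min_le_right _ _).trans (min_le_left _ _))
    · exact (min_le_right _ _).trans ((min_le_right _ _).trans ((min_le_right _ _).trans (min_le_left _ _)))
    · exact (min_le_right _ _).trans ((min_le_right _ _).trans ((min_le_right _ _).trans ((min_le_right _ _).trans (min_le_left _ _))))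
    · exact (min_le_right _ _).trans ((min_le_right _ _).trans ((min_le_right _ _).trans ((min_le_right _ _).trans
        ((min_le_right _ _).trans (min_le_left _ _)))))
    · exact (min_le_right _ _).trans ((min_le_right _ _).trans ((min_le_right _ _).trans ((min_le_right _ _).trans
        ((min_le_right _ _).trans (min_le_right _ _)))))
  refine ⟨ρ / 2, by positivity, ?_⟩
  intro σ hσ0 hσle α hα0 hα1 N₀ hN₀ Nbig s₁ s₂ CD cD hs₁ hs₂ hCD hcD
  have h2σ : 2 * σ ≤ ρ := by linarith
  have h2σ0 : 0 < 2 * σ := by positivity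
  -- one constant for the four `N`/`P` majorants
  obtain ⟨CNN, hCNN0, hCN1, hCN2, hCP1, hCP2⟩ : ∃ CNN : ℝ, 0 ≤ CNN ∧ CN ≤ CNN ∧ CN' ≤ CNN ∧ CP ≤ CNN ∧ CP' ≤ CNN :=
    ⟨max (max CN CN') (max CP CP'), le_max_of_le_left (le_max_of_le_left hCN), le_max_of_le_left (le_max_left _ _),
      le_max_of_le_left (le_max_right _ _), le_max_of_le_right (le_max_left _ _), le_max_of_le_right (le_max_right _ _)⟩
  have hK0 : 0 ≤ K261 N₀ (d + 1) ((ℓ : ℝ) + 1) 1 (α * σ) := K261_nonneg (by positivity) zero_le_one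
  -- p38's threshold for the RESCALED family (all constants `c′`-free)
  obtain ⟨M₁, Θ, hM₁, hΘ, h38⟩ := inputs2134_kFam_torus_in d ℓ (δG := 2 * σ) (CP := ((d : ℝ) + 1) * C₂) (CG := CG) (C₁ := CE) (CN := CNN)
    (CD := CD) (cD := cD) (s := sLipT d ℓ) (s₁ := s₁) (s₂ := s₂) (r₀ := 1) (m := 1 / (2 * ((ℓ : ℝ) + 1) ^ 2))
    (c₁ := 2 * K261 N₀ (d + 1) ((ℓ : ℝ) + 1) 1 (α * σ)) (Fintype.card (Fin (d + 1) × Bool)) 1 Nbig h2σ0 (by positivity) hCG hCE hCNN0 hCD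
    hcD (sLipT_nonneg d ℓ) hs₁ hs₂ zero_le_one (by positivity) (by positivity)
  refine ⟨2 * ((Nbig : ℝ) * CG) * K261 N₀ (d + 1) ((ℓ : ℝ) + 1) 1 (α * σ), max M₁ M₃, by positivity, lt_max_of_lt_left hM₁, ?_⟩
  intro m K Mh k R P' hN D hk hk2 a hMha hM8 hR2 hP5 hℓ hpl hM₁' hRM hθ cf hcf w hw hwb hNbig hMout hcfA hcfT hc0A hc0T hD3
  -- ### the torus
  have hMh1 : 1 ≤ Mh := one_le_of_eight_le hM8
  have hP4 : ∀ μ, 4 ≤ P' μ := four_le_of_five_le hP5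
  have hP : ∀ μ, 1 ≤ P' μ := one_le_of_four_le hP4
  have hMh : 2 ≤ Mh := le_trans (by norm_num) hM8
  have hR : 2 * (ℓ + 1) ≤ R := le_trans (by nlinarith : 2 * (ℓ + 1) ≤ 2 * (ℓ + 1) ^ 2) hR2
  have hℓ1 : 1 ≤ ℓ := le_trans (by norm_num) hℓ
  have hLM : M₁ ≤ ((ℓ : ℝ) + 1) * Mh := le_trans (le_max_left _ _) hM₁'
  have hLM₃ : M₃ ≤ ((ℓ : ℝ) + 1) * Mh := le_trans (le_max_right _ _) hM₁'
  have hcf2 : cf ^ 2 ≠ 0 := pow_ne_zero 2 hcf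
  have hcf2pos : 0 < cf ^ 2 := by positivity
  have habs2 : |cf ^ 2| = cf ^ 2 := abs_of_pos hcf2pos
  have habs2i : |(cf ^ 2)⁻¹| = (cf ^ 2)⁻¹ := abs_of_pos (inv_pos.2 hcf2pos)
  have hMpos : 0 < (geomTB D).M := by rw [geomTB_M]; positivity
  have hdnn : ∀ y y' : (geomT D).Site, 0 ≤ (geomT D).dist y y' := distT_nonneg
  -- ### p38's theorem at this torus: smallness + the (2.134) family bound for the rescaled members
  obtain ⟨hsmall, h2134⟩ := h38 D hMh1 hP hR hLM
  -- the global `∂P∂*` (p22), rescaled by `c′⁻²`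
  have hDg' : HasMajorant (g := geomTB D) (blkV1 hN D)
      ((cf ^ 2)⁻¹ • onFun (dE (P := PV d ℓ m K hd hL) cf ∘ₗ (LinearMap.id - RE (domT hN D hk) cf) ∘ₗ dsE cf))
      (fun y y'' => ((d : ℝ) + 1) * C₂ / (geomTB D).len y ^ 2 * Real.exp (-((2 * σ) * (geomTB D).dist y y''))) := by
    refine hasMajorant_mono _ (hasMajorant_smul _ (hDg m K hN D hk hMh1 hP4 hR hLM₃ hcf) _) fun y y'' => ?_
    rw [habs2i]
    have hl := lenTB_pos (D := D) y
    calc (cf ^ 2)⁻¹ * (cf ^ 2 * ((d : ℝ) + 1) * C₂ / (geomTB D).len y ^ 2 * Real.exp (-(δ₂ * (geomTB D).dist y y'')))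
        = ((d : ℝ) + 1) * C₂ / (geomTB D).len y ^ 2 * Real.exp (-(δ₂ * (geomTB D).dist y y'')) := by field_simp
      _ ≤ ((d : ℝ) + 1) * C₂ / (geomTB D).len y ^ 2 * Real.exp (-((2 * σ) * (geomTB D).dist y y'')) :=
          mul_le_mul_of_nonneg_left (exp_le_exp_of_rate (h2σ.trans hρD) (hdnn y y'')) (by positivity)
  have H := h2134 (blkV1 hN D) hDg' (Finset.univ : Finset ↥(cubes D.toDomains))
    (G := fun c => cf ^ 2 • Gl hN hk hMh1 hP4 hMha c (band_le (d := d) (ℓ := ℓ) hb₀ hb₁) (hpl c) w cf)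
    (Ml := fun c => (cf ^ 2)⁻¹ • Ml hN hk hMh1 hP4 hMha c (band_le (d := d) (ℓ := ℓ) hb₀ hb₁) (hpl c) w cf)
    (Pl := fun c => (cf ^ 2)⁻¹ • Pl hN hk hMh1 hP4 hMha c (band_le (d := d) (ℓ := ℓ) hb₀ hb₁) (hpl c) w cf)
    (h := fun c => hB hN D c) (ζ := fun c => zB hN D hMh1 hP4 c)
    (c₀ := fun c x => (cf ^ 2)⁻¹ * c0C hN hk hMh1 hP4 hMha c (band_le (d := d) (ℓ := ℓ) hb₀ hb₁) (hpl c) w cf x)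
    (T := fun c => ST D hMh1 hP4 c) (S := fun c => ST D hMh1 hP4 c) (Score := fun c => SbigT D hMh1 hP4 c)
    (DE := fun _ => (Finset.univ : Finset (Fin (d + 1) × Bool)))
    (E := fun c e => EC hN hk hMh1 hP4 hMha c (band_le (d := d) (ℓ := ℓ) hb₀ hb₁) (hpl c) w cf e)
    (cf := fun c e x => (cf ^ 2)⁻¹ * cfC hN hk hMh1 hP4 hMha c (band_le (d := d) (ℓ := ℓ) hb₀ hb₁) (hpl c) w cf e x)
    (DK := fun _ => ({()} : Finset Unit))
    (N := fun c _ => (cf ^ 2)⁻¹ • NC hN hk hMh1 hP4 hMha c (band_le (d := d) (ℓ := ℓ) hb₀ hb₁) (hpl c) w cf)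
    (z := fun c _ => zC hN hk hMh1 hP4 hMha c (band_le (d := d) (ℓ := ℓ) hb₀ hb₁) (hpl c) w cf)
    -- hnE, hnK
    (fun c _ => le_of_eq Finset.card_univ) (fun c _ => by simp)
    -- hdec
    (fun c _ => hdec_smul Finset.univ ({()} : Finset Unit)
      (N := fun _ => NC hN hk hMh1 hP4 hMha c (band_le (d := d) (ℓ := ℓ) hb₀ hb₁) (hpl c) w cf)
      (z := fun _ => zC hN hk hMh1 hP4 hMha c (band_le (d := d) (ℓ := ℓ) hb₀ hb₁) (hpl c) w cf)
      (hdec_cube hN hk hMh1 hP4 hMha c (band_le (d := d) (ℓ := ℓ) hb₀ hb₁) hM8 hR2 (hpl c) w cf) _)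
    -- hGin
    (fun c _ => by
      refine inMajorant_TB hN (inMajorant_mono (g := geomT D) _ (inMajorant_smul _ (hGin m K hN D hk hMh1 hP4 hMha hMh hR2 hℓ c (hpl c) w cf) (cf ^ 2))
        (K' := fun (y y' : (geomT D).Site) => CG * (geomTB D).len y ^ 2 * Real.exp (-((2 * σ) * (geomT D).dist y y'))) fun y y' _ => ?_)
      rw [habs2, ← sq_mul_pref cf hcf y]
      have := pref_nonneg cf y
      calc cf ^ 2 * (CG * pref cf y * Real.exp (-(ρG * (geomT D).dist y y')))
          = CG * (cf ^ 2 * pref cf y) * Real.exp (-(ρG * (geomT D).dist y y')) := by ring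
        _ ≤ CG * (cf ^ 2 * pref cf y) * Real.exp (-((2 * σ) * (geomT D).dist y y')) :=
            mul_le_mul_of_nonneg_left (exp_le_exp_of_rate (h2σ.trans hρG') (hdnn y y')) (by positivity))
    -- hEG
    (fun c _ e _ => by
      have hx := inMajorant_mono (g := geomT D) _ (inMajorant_smul _ (hEGin m K hN D hk hMh1 hP4 hMha hMh hR2 hℓ c (hpl c) w cf e) (cf ^ 2))
        (K' := fun (y y' : (geomT D).Site) => CE * (geomTB D).len y ^ 2 * Real.exp (-((2 * σ) * (geomT D).dist y y'))) fun y y' _ => by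
          rw [habs2, ← sq_mul_pref cf hcf y]
          have := pref_nonneg cf y
          calc cf ^ 2 * (CE * pref cf y * Real.exp (-(ρE * (geomT D).dist y y')))
              = CE * (cf ^ 2 * pref cf y) * Real.exp (-(ρE * (geomT D).dist y y')) := by ring
            _ ≤ CE * (cf ^ 2 * pref cf y) * Real.exp (-((2 * σ) * (geomT D).dist y y')) :=
                mul_le_mul_of_nonneg_left (exp_le_exp_of_rate (h2σ.trans hρE') (hdnn y y')) (by positivity)
      rw [← mul_smul_comm] at hx
      exact localMajorant_TB hN hx.localMajorant)
    -- hcf, hcfT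
    (fun c _ e _ x => by
      have hl := lenTB_pos (D := D) (blkV1 hN D x)
      rw [abs_mul, habs2i]
      calc (cf ^ 2)⁻¹ * |cfC hN hk hMh1 hP4 hMha c (band_le (d := d) (ℓ := ℓ) hb₀ hb₁) (hpl c) w cf e x|
          ≤ (cf ^ 2)⁻¹ * (s₁ * cf ^ 2 / ((geomTB D).M * (geomTB D).len (blkV1 hN D x) ^ 2)) :=
            mul_le_mul_of_nonneg_left (hcfA c e x) (by positivity)
        _ = s₁ / ((geomTB D).M * (geomTB D).len (blkV1 hN D x) ^ 2) := by field_simp)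
    (fun c _ e _ x hx => hcfT c e x (right_ne_zero_of_mul hx))
    -- hc₀, hc₀T
    (fun c _ x => by
      have hl := lenTB_pos (D := D) (blkV1 hN D x)
      rw [abs_mul, habs2i]
      calc (cf ^ 2)⁻¹ * |c0C hN hk hMh1 hP4 hMha c (band_le (d := d) (ℓ := ℓ) hb₀ hb₁) (hpl c) w cf x|
          ≤ (cf ^ 2)⁻¹ * (s₂ * cf ^ 2 / ((geomTB D).M * (geomTB D).len (blkV1 hN D x) ^ 2)) :=
            mul_le_mul_of_nonneg_left (hc0A c x) (by positivity)
        _ = s₂ / ((geomTB D).M * (geomTB D).len (blkV1 hN D x) ^ 2) := by field_simp)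
    (fun c _ x hx => hc0T c x (right_ne_zero_of_mul hx))
    -- hh1, hhS, hST, hLip
    (fun c _ x => abs_hB_le_one hN D hMh1 hP c x)
    (fun c _ x hx => blkV1_mem_QT_of_hB_ne_zero hN D hMh hR hP4 c hx)
    (fun c _ => fun _ hy => hy)
    (fun c _ x x' => abs_hT_sub_le_distT hℓ1 hMh hR hP5 c (toBox hN x.src) (toBox hN x'.src))
    -- hNin, hNout
    (fun c _ k _ => by
      refine inMajorant_TB hN (inMajorant_mono (g := geomT D) _ (inMajorant_smul _ (hNin m K hN D hk hMh1 hP4 hMha hMh hR2 hℓ c (hpl c) w cf) ((cf ^ 2)⁻¹))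
        (K' := fun (y y'' : (geomT D).Site) => CNN / (geomTB D).len y ^ 2 * Real.exp (-((2 * σ) * (geomT D).dist y y''))) fun y y'' _ => ?_)
      rw [habs2i]
      have hl := lenTB_pos (D := D) y
      calc (cf ^ 2)⁻¹ * (CN * (pref cf y)⁻¹ * Real.exp (-(ρN * (geomT D).dist y y'')))
          = CN * ((cf ^ 2)⁻¹ * (pref cf y)⁻¹) * Real.exp (-(ρN * (geomT D).dist y y'')) := by ring
        _ = CN / (geomTB D).len y ^ 2 * Real.exp (-(ρN * (geomT D).dist y y'')) := by rw [inv_sq_mul_pref_inv cf hcf y]; ring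
        _ ≤ CNN / (geomTB D).len y ^ 2 * Real.exp (-((2 * σ) * (geomT D).dist y y'')) :=
            mul_le_mul (div_le_div_of_nonneg_right hCN1 (by positivity)) (exp_le_exp_of_rate (h2σ.trans hρN1) (hdnn y y''))
              (Real.exp_nonneg _) (by positivity))
    (fun c _ k _ => by
      have hx := outMajorant_mono (g := geomT D) _ (outMajorant_smul _ (hNout m K hN D hk hMh1 hP4 hMha hMh hR2 hℓ c (hpl c) w cf) ((cf ^ 2)⁻¹))
        (K' := fun (y y'' : (geomT D).Site) => CNN / (geomTB D).len y ^ 2 * Real.exp (-((2 * σ) * (geomT D).dist y y''))) fun y _ y'' => by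
          rw [habs2i]
          have hl := lenTB_pos (D := D) y
          calc (cf ^ 2)⁻¹ * (CN' * (pref cf y)⁻¹ * Real.exp (-(ρN' * (geomT D).dist y y'')))
              = CN' * ((cf ^ 2)⁻¹ * (pref cf y)⁻¹) * Real.exp (-(ρN' * (geomT D).dist y y'')) := by ring
            _ = CN' / (geomTB D).len y ^ 2 * Real.exp (-(ρN' * (geomT D).dist y y'')) := by rw [inv_sq_mul_pref_inv cf hcf y]; ring
            _ ≤ CNN / (geomTB D).len y ^ 2 * Real.exp (-((2 * σ) * (geomT D).dist y y'')) :=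
                mul_le_mul (div_le_div_of_nonneg_right hCN2 (by positivity)) (exp_le_exp_of_rate (h2σ.trans hρN2) (hdnn y y''))
                  (Real.exp_nonneg _) (by positivity)
      exact outMajorant_TB hN hx)
    -- hz
    (fun c _ k _ x => abs_zC_le hN hk hMh1 hP4 hMha c (band_le (d := d) (ℓ := ℓ) hb₀ hb₁) (hpl c) w cf x)
    -- hPlin, hPlout
    (fun c _ => by
      refine inMajorant_TB hN (inMajorant_mono (g := geomT D) _ (inMajorant_smul _ (hPlin m K hN D hk hMh1 hP4 hMha hMh hR2 hℓ c (hpl c) w cf) ((cf ^ 2)⁻¹))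
        (K' := fun (y y'' : (geomT D).Site) => CNN / (geomTB D).len y ^ 2 * Real.exp (-((2 * σ) * (geomT D).dist y y''))) fun y y'' _ => ?_)
      rw [habs2i]
      have hl := lenTB_pos (D := D) y
      calc (cf ^ 2)⁻¹ * (CP * (pref cf y)⁻¹ * Real.exp (-(ρP * (geomT D).dist y y'')))
          = CP * ((cf ^ 2)⁻¹ * (pref cf y)⁻¹) * Real.exp (-(ρP * (geomT D).dist y y'')) := by ring
        _ = CP / (geomTB D).len y ^ 2 * Real.exp (-(ρP * (geomT D).dist y y'')) := by rw [inv_sq_mul_pref_inv cf hcf y]; ring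
        _ ≤ CNN / (geomTB D).len y ^ 2 * Real.exp (-((2 * σ) * (geomT D).dist y y'')) :=
            mul_le_mul (div_le_div_of_nonneg_right hCP1 (by positivity)) (exp_le_exp_of_rate (h2σ.trans hρP1) (hdnn y y''))
              (Real.exp_nonneg _) (by positivity))
    (fun c _ => by
      have hx := outMajorant_mono (g := geomT D) _ (outMajorant_smul _ (hPlout m K hN D hk hMh1 hP4 hMha hMh hR2 hℓ c (hpl c) w cf) ((cf ^ 2)⁻¹))
        (K' := fun (y y'' : (geomT D).Site) => CNN / (geomTB D).len y ^ 2 * Real.exp (-((2 * σ) * (geomT D).dist y y''))) fun y _ y'' => by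
          rw [habs2i]
          have hl := lenTB_pos (D := D) y
          calc (cf ^ 2)⁻¹ * (CP' * (pref cf y)⁻¹ * Real.exp (-(ρP' * (geomT D).dist y y'')))
              = CP' * ((cf ^ 2)⁻¹ * (pref cf y)⁻¹) * Real.exp (-(ρP' * (geomT D).dist y y'')) := by ring
            _ = CP' / (geomTB D).len y ^ 2 * Real.exp (-(ρP' * (geomT D).dist y y'')) := by rw [inv_sq_mul_pref_inv cf hcf y]; ring
            _ ≤ CNN / (geomTB D).len y ^ 2 * Real.exp (-((2 * σ) * (geomT D).dist y y'')) :=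
                mul_le_mul (div_le_div_of_nonneg_right hCP2 (by positivity)) (exp_le_exp_of_rate (h2σ.trans hρP2) (hdnn y y''))
                  (Real.exp_nonneg _) (by positivity)
      exact outMajorant_TB hN hx)
    -- hζ0, hζ1, hζS
    (fun c _ x => zetaT_nonneg hMh1 hP4 c (toBox hN x.src)) (fun c _ x => zetaT_le_one hMh1 hP4 c (toBox hN x.src))
    (fun c _ x hx => not_mem_QbigT_of_zetaT_ne_one hMh1 hP4 c hx)
    -- hD3 (rescaled)
    (fun c _ => by
      have hx := hasMajorant_smul _ (hD3 c) ((cf ^ 2)⁻¹)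
      have eop : (cf ^ 2)⁻¹ • (mulOp (zB hN D hMh1 hP4 c) *
            (onFun (dE (P := PV d ℓ m K hd hL) cf ∘ₗ (LinearMap.id - RE (domT hN D hk) cf) ∘ₗ dsE cf) -
              Pl hN hk hMh1 hP4 hMha c (band_le (d := d) (ℓ := ℓ) hb₀ hb₁) (hpl c) w cf) * mulOp (hB hN D c)) =
          mulOp (zB hN D hMh1 hP4 c) *
            ((cf ^ 2)⁻¹ • onFun (dE (P := PV d ℓ m K hd hL) cf ∘ₗ (LinearMap.id - RE (domT hN D hk) cf) ∘ₗ dsE cf) -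
              (cf ^ 2)⁻¹ • Pl hN hk hMh1 hP4 hMha c (band_le (d := d) (ℓ := ℓ) hb₀ hb₁) (hpl c) w cf) * mulOp (hB hN D c) := by
        simp only [smul_sub, mul_sub, sub_mul, mul_smul_comm, smul_mul_assoc]
      rw [eop] at hx
      refine hasMajorant_mono _ hx fun y y'' => le_of_eq ?_
      rw [habs2i]
      have hl := lenTB_pos (D := D) y
      field_simp)
    -- hgap
    (fun c _ y y'' hy hy'' => gap_QT hℓ1 hMh hR hP5 c hy hy'')
  -- ### back to the TRUE family: `K(rescaled)·(c′²G_□) = K·G_□`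
  have e1 : σ * ((d : ℝ) + 1) / ((d : ℝ) + 1) = σ := by field_simp
  have e3 : (2 * (σ * ((d : ℝ) + 1) / ((d : ℝ) + 1))) / 2 = 2 * σ / 2 := by rw [e1]
  have hconv : ∀ {T : Module.End ℝ (PBond (PV d ℓ m K hd hL) 0 → ℝ)} {θ : ℝ},
      HasMajorant (g := geomTB D) (blkV1 hN D) T (fun (y y' : (geomT D).Site) => θ * Real.exp (-(2 * σ / 2 * (geomT D).dist y y'))) →
      HasMajorant (g := geomT D) (blkV1 hN D) T
        (fun y y' => θ * Real.exp (-((2 * (σ * ((d : ℝ) + 1) / ((d : ℝ) + 1))) / 2 * (geomT D).dist y y'))) :=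
    fun h => hasMajorant_T_of_TB hN (hasMajorant_mono (g := geomTB D) _ h fun y y' => le_of_eq (by rw [e3]))
  have h2134' := fun c c' => hconv (by
    have h := H c (Finset.mem_univ _) c' (Finset.mem_univ _)
    rw [kFam_smul, smul_mul_smul_comm, inv_mul_cancel₀ hcf2, one_smul] at h
    exact h)
  -- ### the two-family skeleton
  have hθ' : Real.exp (-(α * (σ * ((d : ℝ) + 1) / ((d : ℝ) + 1)))) * ((ℓ : ℝ) + 1) ^ ((2 * (d + 1 : ℕ) : ℝ) / N₀) < 1 := by
    rw [e1]; exact hθ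
  have h2133 : ∀ c : ↥(cubes D.toDomains), LocalMajorant (g := geomT D) (blkV1 hN D)
      (Gl hN hk hMh1 hP4 hMha c (band_le (d := d) (ℓ := ℓ) hb₀ hb₁) (hpl c) w cf) (ST D hMh1 hP4 c)
      (fun y y' => CG * pref cf y * Real.exp (-((2 * (σ * ((d : ℝ) + 1) / ((d : ℝ) + 1))) / 2 * (geomT D).dist y y'))) := by
    intro c
    refine (inMajorant_mono _ (hGin m K hN D hk hMh1 hP4 hMha hMh hR2 hℓ c (hpl c) w cf) fun y y' _ => ?_).localMajorant
    rw [e3]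
    have := pref_nonneg cf y
    exact mul_le_mul_of_nonneg_left (exp_le_exp_of_rate (by linarith) (hdnn y y')) (by positivity)
  have hsk := prop26_2136_kLevel_skeleton₂' hN D hk hMh hR hP5 (δ := σ * ((d : ℝ) + 1)) (A := CG) (by positivity) hCG α hα0 hα1 N₀ hN₀
    hRM hθ' hcf hw Nbig (hNov_SbigT_of_QbigT D hMh1 hP4 hNbig)
    (fun c => Gl hN hk hMh1 hP4 hMha c (band_le (d := d) (ℓ := ℓ) hb₀ hb₁) (hpl c) w cf)
    (fun c => Ml hN hk hMh1 hP4 hMha c (band_le (d := d) (ℓ := ℓ) hb₀ hb₁) (hpl c) w cf)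
    (fun c => Pl hN hk hMh1 hP4 hMha c (band_le (d := d) (ℓ := ℓ) hb₀ hb₁) (hpl c) w cf) h2133
    (fun c => hagree_cube hN hk hMh1 hP4 hMha c (band_le (d := d) (ℓ := ℓ) hb₀ hb₁) hk2 hM8 hR2 (hpl c) w hcf
      (fun i hi _ => band_of_global hN hk hMh1 hP4 c (le_of_lt hb₀) hcf w hwb i hi))
    (fun c => hinvl_cube hN hk hMh1 hP4 hMha c (band_le (d := d) (ℓ := ℓ) hb₀ hb₁) ha₀ hM8 hR2 (hpl c) w hcf) hMout _ ?hθ₀ h2134' ?hsm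
  case hθ₀ =>
    have hs := sLipT_nonneg d ℓ
    positivity
  case hsm =>
    rw [e1]
    have hs := sLipT_nonneg d ℓ
    exact small_of_small_two (by positivity) hsmall
  -- ### the final constant: `(1 − N²θ₀c₁)⁻¹ ≤ 2`
  refine hasMajorant_mono _ hsk fun y y' => ?_
  rw [e1]
  have hs := sLipT_nonneg d ℓ
  exact final_const_le (Nat.cast_nonneg _) hCG hK0 (by positivity) (pref_nonneg cf y) (Real.exp_nonneg _) hsmall


open Classical in
/-- **PROPOSITION 2.6 (2.136)₁ AT k LEVELS FOR THE GENUINE G — ONLY LINE 3 DISPLAYED, AT ANY RATE `σ ≤ σ₀`** (`prop26_2136_kLevel_final` with the rate a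
parameter: overlap, `hMout`, line-1 sizes discharged as in v1.2/v1.3). [cite: Balaban1984PropagatorsII, Prop. 2.6 (2.136) p.247, (2.92) p.239 (line 3), (2.133)–(2.135) p.247] -/
theorem prop26_2136_kLevel_final_le (d ℓ : ℕ) (hd : 1 ≤ d + 1) (hL : Odd (ℓ + 1) ∧ 1 < ℓ + 1) {b₀ b₁ : ℝ} (hb₀ : 0 < b₀) (hb₁ : b₀ ≤ b₁) :
    ∃ σ₀ : ℝ, 0 < σ₀ ∧ ∀ (σ : ℝ), 0 < σ → σ ≤ σ₀ → ∀ (α : ℝ), 0 ≤ α → α ≤ 1 → ∀ (N₀ : ℕ), 0 < N₀ → ∀ {CD cD : ℝ}, 0 ≤ CD → 0 < cD →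
    ∃ A M₁ : ℝ, 0 ≤ A ∧ 0 < M₁ ∧
    ∀ (m K : ℕ) {Mh k R : ℕ} {P' : Fin (d + 1) → ℕ}
      (hN : ∀ μ, N0 ℓ Mh k P' μ = (PV d ℓ m K hd hL).sitesPerDir 0) (D : TDomains d ℓ Mh k P' R) (hk : k ≤ m + K) (_ : 2 ≤ k)
      {a : ℕ} (hMha : Mh = (ℓ + 1) ^ a) (hM8 : 8 ≤ Mh) (_ : 2 * (ℓ + 1) ^ 2 ≤ R) (hP5 : ∀ μ, 5 ≤ P' μ) (_ : 4 ≤ ℓ)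
      (hpl : ∀ c : ↥(cubes D.toDomains), Placed ℓ k P' c.1)
      (_ : M₁ ≤ ((ℓ : ℝ) + 1) * Mh) (_ : N₀ + 1 ≤ R * ((ℓ + 1) * Mh))
      (_ : Real.exp (-(α * σ)) * ((ℓ : ℝ) + 1) ^ ((2 * (d + 1 : ℕ) : ℝ) / N₀) < 1)
      {cf : ℝ} (hcf : cf ≠ 0) {w : BondIdx (domT hN D hk) → ℝ} (hw : ∀ i, 0 < w i) (_ : GlobalBand b₀ b₁ cf w)
      (_ : ∀ c : ↥(cubes D.toDomains), HasMajorant (g := geomTB D) (blkV1 hN D)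
        (mulOp (zB hN D (one_le_of_eight_le hM8) (four_le_of_five_le hP5) c) *
          (onFun (dE (P := PV d ℓ m K hd hL) cf ∘ₗ (LinearMap.id - RE (domT hN D hk) cf) ∘ₗ dsE cf) -
            Pl hN hk (one_le_of_eight_le hM8) (four_le_of_five_le hP5) hMha c (band_le (d := d) (ℓ := ℓ) hb₀ hb₁) (hpl c) w cf) *
          mulOp (hB hN D c))
        (fun y y'' => CD * cf ^ 2 * Real.exp (-(cD * (geomTB D).M)) / (geomTB D).len y ^ 2 * Real.exp (-((2 * σ) * (geomTB D).dist y y'')))),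
      HasMajorant (g := geomT D) (blkV1 hN D) (onFun (GE (domT hN D hk) hcf hw))
        (fun y y' => A * pref cf y * Real.exp (-(delta3 α (2 * σ) * (geomT D).dist y y'))) := by
  obtain ⟨σ₀, hσ₀, h⟩ := prop26_2136_kLevel_assembly_le d ℓ hd hL hb₀ hb₁
  refine ⟨σ₀, hσ₀, fun σ hσ0 hσle α hα0 hα1 N₀ hN₀ CD cD hCD hcD => ?_⟩
  have hs₁ : 0 ≤ C1F d ℓ * ((ℓ : ℝ) + 1) ^ 3 := by have := C1F_nonneg d ℓ; positivity
  have hs₂ : 0 ≤ ((d : ℝ) + 1) * C2F d ℓ * ((ℓ : ℝ) + 1) := by have := C2F_nonneg d ℓ; positivity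
  obtain ⟨A, M₁, hA, hM₁, h2⟩ := h σ hσ0 hσle α hα0 hα1 N₀ hN₀ (3 * 9 ^ (d + 1)) hs₁ hs₂ hCD hcD
  refine ⟨A, M₁, hA, hM₁, ?_⟩
  intro m K Mh k R P' hN D hk hk2 a hMha hM8 hR2 hP5 hℓ hpl hLM hRM hθ cf hcf w hw hwb hD3
  exact h2 m K hN D hk hk2 hMha hM8 hR2 hP5 hℓ hpl hLM hRM hθ hcf hw hwb
    (card_filter_mem_QbigT_le D hL (le_trans (by norm_num) hM8) hR2 (one_le_of_eight_le hM8) (four_le_of_five_le hP5))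
    (fun c => outLoc_Ml_hB hN hk _ _ hMha c _ hM8 hR2 hP5 (hpl c) w cf
      (fun e x hx => cfC_supp hN hk _ _ hMha c _ hM8 hR2 hP5 (hpl c) w cf e x hx)
      (fun x hx => c0C_supp hN hk _ _ hMha c _ hM8 hR2 hP5 (hpl c) w cf x hx))
    (fun c e x => abs_cfC_le hN hk _ _ hMha c _ hM8 hR2 hP5 (hpl c) w cf e x)
    (fun c e x hx => cfC_supp hN hk _ _ hMha c _ hM8 hR2 hP5 (hpl c) w cf e x hx)
    (fun c x => abs_c0C_le hN hk _ _ hMha c _ hM8 hR2 hP5 (hpl c) w cf x)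
    (fun c x hx => c0C_supp hN hk _ _ hMha c _ hM8 hR2 hP5 (hpl c) w cf x hx) hD3

end Rate

/-! ## §7  (v1.5) The Lemma-2.1 bookkeeping ABSORBED: for `α > 0` the budget exponent `N₀` is chosen inside — one threshold `M₂ ≤ L·M_h` remains -/

section Budget

/-- the budget inequality `e^{−ασ}·L^{2(d+1)/N₀} < 1` holds for `N₀ := ⌈2(d+1)·log L/(ασ)⌉₊ + 1` (`α, σ > 0`, `L ≥ 1`). [folklore] -/
private theorem budget_lt_one {d ℓ : ℕ} {α σ : ℝ} (hα : 0 < α) (hσ : 0 < σ) :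
    Real.exp (-(α * σ)) * ((ℓ : ℝ) + 1) ^ ((2 * (d + 1 : ℕ) : ℝ) / (⌈2 * ((d : ℝ) + 1) * Real.log ((ℓ : ℝ) + 1) / (α * σ)⌉₊ + 1 : ℕ)) < 1 := by
  have hL : (0 : ℝ) < (ℓ : ℝ) + 1 := by positivity
  have hlog : 0 ≤ Real.log ((ℓ : ℝ) + 1) := Real.log_nonneg (by linarith [(Nat.cast_nonneg ℓ : (0 : ℝ) ≤ ℓ)])
  have hN : 2 * ((d : ℝ) + 1) * Real.log ((ℓ : ℝ) + 1) / (α * σ) <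
      ((⌈2 * ((d : ℝ) + 1) * Real.log ((ℓ : ℝ) + 1) / (α * σ)⌉₊ + 1 : ℕ) : ℝ) := by
    push_cast
    exact lt_of_le_of_lt (Nat.le_ceil _) (lt_add_one _)
  have hNpos : (0 : ℝ) < ((⌈2 * ((d : ℝ) + 1) * Real.log ((ℓ : ℝ) + 1) / (α * σ)⌉₊ + 1 : ℕ) : ℝ) := by positivity
  have hασ : 0 < α * σ := mul_pos hα hσ
  have key : (2 * (d + 1 : ℕ) : ℝ) / (⌈2 * ((d : ℝ) + 1) * Real.log ((ℓ : ℝ) + 1) / (α * σ)⌉₊ + 1 : ℕ) * Real.log ((ℓ : ℝ) + 1) < α * σ := by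
    rw [div_mul_eq_mul_div, div_lt_iff₀ hNpos]
    rw [div_lt_iff₀ hασ] at hN
    push_cast at hN ⊢
    nlinarith
  rw [Real.rpow_def_of_pos hL, ← Real.exp_add, Real.exp_lt_one_iff]
  nlinarith

open Classical in
/-- **PROPOSITION 2.6 (2.136)₁ AT k LEVELS FOR THE GENUINE G — ONLY LINE 3 DISPLAYED, ONE SIZE THRESHOLD** (`prop26_2136_kLevel_final_le` with the Lemma-2.1
exponent `N₀` chosen inside for `α > 0`; the three budget hypotheses collapse to `M₂ ≤ L·M_h`).
[cite: Balaban1984PropagatorsII, Prop. 2.6 (2.136) p.247, Lemma 2.1 p.234, (2.92) p.239 (line 3)] -/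
theorem prop26_2136_kLevel_final_M (d ℓ : ℕ) (hd : 1 ≤ d + 1) (hL : Odd (ℓ + 1) ∧ 1 < ℓ + 1) {b₀ b₁ : ℝ} (hb₀ : 0 < b₀) (hb₁ : b₀ ≤ b₁) :
    ∃ σ₀ : ℝ, 0 < σ₀ ∧ ∀ (σ : ℝ), 0 < σ → σ ≤ σ₀ → ∀ (α : ℝ), 0 < α → α ≤ 1 → ∀ {CD cD : ℝ}, 0 ≤ CD → 0 < cD →
    ∃ A M₂ : ℝ, 0 ≤ A ∧ 0 < M₂ ∧
    ∀ (m K : ℕ) {Mh k R : ℕ} {P' : Fin (d + 1) → ℕ}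
      (hN : ∀ μ, N0 ℓ Mh k P' μ = (PV d ℓ m K hd hL).sitesPerDir 0) (D : TDomains d ℓ Mh k P' R) (hk : k ≤ m + K) (_ : 2 ≤ k)
      {a : ℕ} (hMha : Mh = (ℓ + 1) ^ a) (hM8 : 8 ≤ Mh) (_ : 2 * (ℓ + 1) ^ 2 ≤ R) (hP5 : ∀ μ, 5 ≤ P' μ) (_ : 4 ≤ ℓ)
      (hpl : ∀ c : ↥(cubes D.toDomains), Placed ℓ k P' c.1)
      (_ : M₂ ≤ ((ℓ : ℝ) + 1) * Mh)
      {cf : ℝ} (hcf : cf ≠ 0) {w : BondIdx (domT hN D hk) → ℝ} (hw : ∀ i, 0 < w i) (_ : GlobalBand b₀ b₁ cf w)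
      (_ : ∀ c : ↥(cubes D.toDomains), HasMajorant (g := geomTB D) (blkV1 hN D)
        (mulOp (zB hN D (one_le_of_eight_le hM8) (four_le_of_five_le hP5) c) *
          (onFun (dE (P := PV d ℓ m K hd hL) cf ∘ₗ (LinearMap.id - RE (domT hN D hk) cf) ∘ₗ dsE cf) -
            Pl hN hk (one_le_of_eight_le hM8) (four_le_of_five_le hP5) hMha c (band_le (d := d) (ℓ := ℓ) hb₀ hb₁) (hpl c) w cf) *
          mulOp (hB hN D c))
        (fun y y'' => CD * cf ^ 2 * Real.exp (-(cD * (geomTB D).M)) / (geomTB D).len y ^ 2 * Real.exp (-((2 * σ) * (geomTB D).dist y y'')))),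
      HasMajorant (g := geomT D) (blkV1 hN D) (onFun (GE (domT hN D hk) hcf hw))
        (fun y y' => A * pref cf y * Real.exp (-(delta3 α (2 * σ) * (geomT D).dist y y'))) := by
  obtain ⟨σ₀, hσ₀, h⟩ := prop26_2136_kLevel_final_le d ℓ hd hL hb₀ hb₁
  refine ⟨σ₀, hσ₀, fun σ hσ0 hσle α hα0 hα1 CD cD hCD hcD => ?_⟩
  obtain ⟨A, M₁, hA, hM₁, h2⟩ := h σ hσ0 hσle α hα0.le hα1 (⌈2 * ((d : ℝ) + 1) * Real.log ((ℓ : ℝ) + 1) / (α * σ)⌉₊ + 1)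
    (Nat.succ_pos _) hCD hcD
  refine ⟨A, max M₁ ((⌈2 * ((d : ℝ) + 1) * Real.log ((ℓ : ℝ) + 1) / (α * σ)⌉₊ + 1 : ℕ) + 1), hA, lt_max_of_lt_left hM₁, ?_⟩
  intro m K Mh k R P' hN D hk hk2 a hMha hM8 hR2 hP5 hℓ hpl hM₂ cf hcf w hw hwb hD3
  have hLM : M₁ ≤ ((ℓ : ℝ) + 1) * Mh := (le_max_left _ _).trans hM₂
  have hR1 : 1 ≤ R := le_trans (by nlinarith : 1 ≤ 2 * (ℓ + 1) ^ 2) hR2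
  have hRM : (⌈2 * ((d : ℝ) + 1) * Real.log ((ℓ : ℝ) + 1) / (α * σ)⌉₊ + 1) + 1 ≤ R * ((ℓ + 1) * Mh) := by
    have h1 : ((⌈2 * ((d : ℝ) + 1) * Real.log ((ℓ : ℝ) + 1) / (α * σ)⌉₊ + 1 : ℕ) : ℝ) + 1 ≤ ((ℓ : ℝ) + 1) * Mh :=
      (le_max_right _ _).trans hM₂
    have h2 : (⌈2 * ((d : ℝ) + 1) * Real.log ((ℓ : ℝ) + 1) / (α * σ)⌉₊ + 1) + 1 ≤ (ℓ + 1) * Mh := by exact_mod_cast h1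
    calc (⌈2 * ((d : ℝ) + 1) * Real.log ((ℓ : ℝ) + 1) / (α * σ)⌉₊ + 1) + 1 ≤ (ℓ + 1) * Mh := h2
      _ = 1 * ((ℓ + 1) * Mh) := (one_mul _).symm
      _ ≤ R * ((ℓ + 1) * Mh) := Nat.mul_le_mul_right _ hR1
  exact h2 m K hN D hk hk2 hMha hM8 hR2 hP5 hℓ hpl hLM hRM (budget_lt_one hα0 hσ0) hcf hw hwb hD3

end Budget

end

end Literature.MathematicalPhysics.QuantumFieldTheory.Balaban1983to89.B6Prop26KLevelAssemblyV1
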